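import Literature.Analysis.ValidatedNumerics.TaylorModelIntegralCert3DWeighted
import Literature.Analysis.ValidatedNumerics.TaylorModelIntegralCert2DVertex
import HarnessLib

/-!
# Duffy's transformation for vertex singularities of triple integrals, with kernel-checked certificates

Trunk T-ANA (Analysis/ValidatedNumerics); namespace `Literature.Analysis.ValidatedNumerics.PolyMP`.
Sequel of `TaylorModelIntegralCert2DVertex.lean` (the square: two triangles, Jacobians `κ₁ (x − x0)`, `κ₂ (y − y0)`)
and of `TaylorModelIntegralCert3DWeighted.lean` (the face-weighted 3-D kd-tree certificate `leafCheckWL3` /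
`treeCheckWL3` / `integral_bounds_of_leafCheckWL3` for `∫∫∫ Π_faces d^α (−log d)^κ · F`).

Duffy, *Quadrature over a pyramid or cube of integrands with a singularity at a vertex*, SIAM J. Numer. Anal. 19
(1982) 1260–1262: a cube with an integrand singular at a vertex "can be divided into three pyramids", each with the
singularity at its apex, and each pyramid is mapped onto a cube by `x = u`, `y = u v`, `z = u w`, whose Jacobian `u²`
removes vertex singularities of the type `1/r²` (Davis–Rabinowitz, *Methods of Numerical Integration*, 2nd ed. (1984),
Sect. 5.8: integrands `r^α φ h g` over the hypercube with `α > −d`, Duffy's transformation among the devices;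
Mousavi–Sukumar, Comput. Mech. 45 (2010) 127–140, Sect. 1 and Appendix A: the generalized Duffy transformation onto
pyramids, the Jacobian cancelling the singular factor).

This module formalises exactly this reduction for a rational box `R = [x0, x1] × [y0, y1] × [z0, z1]` with the
singular vertex at `(x0, y0, z0)` and composes it with the face-weighted certificate (the algebraic face weight
`(u − u0)^{2−σ}` of that module plays the role of the Gauss–Jacobi rule in the `u`-direction):

* Part A — what a checked face-weighted certificate provides beyond the enclosure: JOINT integrability of the weighted
  integrand `wfunL3 ω R F` on the closed box (`integrableOn_wfunL3_of_leafCheckWL3`), hence (Fubini, twice) the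
  iterated triple integral is the set integral over the box (`intervalIntegral_iterated3_eq_setIntegral_prod`).
* Part B — Duffy's change of variables as identities of SET integrals on `ℝ × ℝ × ℝ` (Mathlib's change-of-variables
  theorem with the explicit Jacobian determinants `κ κ' (x − x0)²`, `−κ κ' (y − y0)²`, `κ κ' (z − z0)²`, computed as
  `3 × 3` determinants in coordinates): the maps `duffy3X` / `duffy3Y` / `duffy3Z` onto the three pyramids with apex
  `(x0, y0, z0)` and bases the far faces `x = x1`, `y = y1`, `z = z1` (slopes `κ₁ (x1 − x0) = y1 − y0`,
  `κ₁' (x1 − x0) = z1 − z0`, `κ₂ (y1 − y0) = x1 − x0`, `κ₂' (y1 − y0) = z1 − z0`, `κ₃ (z1 − z0) = x1 − x0`,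
  `κ₃' (z1 − z0) = y1 − y0`), their injectivity and images (half-open pyramids tiling the box up to the vertex),
  `setIntegral_duffy3X/Y/Z` and the decomposition `duffy3_split`:
  `∫_R f = Σ_{w ∈ {x,y,z}} ∫_{w0}^{w1} ∫_0^1 ∫_0^1 κ κ' (w − w0)² f(pyramid point) dt ds dw`, together with the transfer of
  integrability — NO hypothesis on `f` beyond integrability of the three transformed integrands on their closed
  parameter boxes.
* Part C — the certificate `integral_bounds_of_duffy3CheckWL3`: if the three transformed integrands agree on the OPEN
  parameter boxes with face-weighted code-list integrands `wfunL3 ωᵢ ⟨w0, w1, 0, 1, 0, 1⟩ Fᵢ` whose kd-tree certificates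
  check (`decide`), then `f` is integrable on `R` and `lo₁ + lo₂ + lo₃ ≤ ∫_{x0}^{x1} ∫_{y0}^{y1} ∫_{z0}^{z1} f ≤ hi₁ + hi₂ + hi₃`.
  Typical clients: `(x + y + z)^{-s}`, `(x² + y² + z²)^{-s/2}` (`0 < s < 3`), possibly times face-singular factors
  `z^{-1/2}` etc. (they become face weights of the parameter box), times analytic factors.

Singularities at another vertex reduce to this case by reflecting the box; edge (line) singularities and interior
point singularities are not treated here (Deliberately NOT here: dimension `≥ 4`, logarithmic vertex factors).
Problem-independent; no facts, no axioms; all certificate data computable over `ℚ` and `ℤ`.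

References: [cite: Duffy1982, p. 1260]; [cite: MousaviSukumar2009, Sect. 1 and Appendix A];
[cite: DavisRabinowitz1984, Sect. 5.8]; [cite: DavisRabinowitz1984, Sect. 5.6]; [cite: DavisRabinowitz1984, Sect. 2.12.5];
[cite: MakinoBerz2003, Algorithm 2]; [cite: MahboubiMelquiondSibutpinote2016, Sect. 3.3].
-/

open MeasureTheory intervalIntegral Set
open scoped Interval

namespace Literature.Analysis.ValidatedNumerics

namespace PolyMP

open Literature.Analysis.ValidatedNumerics.NumericsMP
open Literature.Analysis.ValidatedNumerics.ExpPoly (Poly)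
open Literature.Analysis.ValidatedNumerics.ExpPoly
open Literature.Analysis.ValidatedNumerics.TaylorForm

/-- [folklore] -/
private theorem sep_of_flagWL3' {t : Bool} {α a b : ℚ} (h : (t = true ∨ α = 0) ∨ a < b) :
    t = false → α ≠ 0 → a < b := by
  intro ht hα
  rcases h with (h | h) | h
  · rw [ht] at h; exact absurd h Bool.false_ne_true
  · exact absurd h hα
  · exact h

/-! ### Part A. What the face-weighted 3-D certificate provides beyond the enclosure: joint integrability -/

/-- **Joint integrability on an accepted leaf** (3-D): the weighted integrand `w · F` of an accepted leaf `B` of the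
face-weighted certificate is integrable on the closed leaf `[x0, x1] × [y0, y1] × [z0, z1]` for Lebesgue measure —
the tensor weight is a product of three integrable one-dimensional algebraic–logarithmic factors and the
Taylor-modelled regular part is jointly measurable and bounded (op. cit. Sect. 2.12.5: the singular weight is
integrated exactly, the regular factor is bounded; Sect. 5.6: the weight of a product rule over the cube factorises).
[cite: DavisRabinowitz1984, Sect. 2.12.5] [cite: DavisRabinowitz1984, Sect. 5.6] [cite: MakinoBerz2003, Algorithm 2] -/
theorem integrableOn_prod_of_leafEnclWL3 {S : ℕ} (hS : 0 < S) (F : BExpr3T) (ω : WLPrm3) (R B : Box3Q) (P : EPrm)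
    (hok : (leafEnclWL3 S F ω R B P).2 = true) :
    IntegrableOn (fun p : ℝ × ℝ × ℝ => wfunL3 ω R F p.1 p.2.1 p.2.2)
      (Icc (B.x0 : ℝ) B.x1 ×ˢ (Icc (B.y0 : ℝ) B.y1 ×ˢ Icc (B.z0 : ℝ) B.z1)) volume := by
  simp only [leafEnclWL3, Bool.and_eq_true, Bool.or_eq_true, decide_eq_true_eq] at hok
  obtain ⟨⟨⟨⟨⟨⟨⟨⟨⟨⟨⟨⟨⟨⟨⟨⟨⟨⟨⟨hT, hacc⟩, hdx⟩, hdy⟩, hdz⟩, hsx0⟩, hsx1⟩, hsy0⟩, hsy1⟩, hsz0⟩, hsz1⟩, hRx0⟩,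
    hRx1⟩, hRy0⟩, hRy1⟩, hRz0⟩, hRz1⟩, hx⟩, hy⟩, hz⟩ := hok
  set h : ℚ := (B.x1 - B.x0) / 2 with hh
  set k : ℚ := (B.y1 - B.y0) / 2 with hk
  set l : ℚ := (B.z1 - B.z0) / 2 with hl
  set cx : ℚ := (B.x0 + B.x1) / 2 with hcx
  set cy : ℚ := (B.y0 + B.y1) / 2 with hcy
  set cz : ℚ := (B.z0 + B.z1) / 2 with hcz
  set dlx : ℚ := B.x0 - R.x0 with hdlx
  set drx : ℚ := R.x1 - B.x1 with hdrx
  set dly : ℚ := B.y0 - R.y0 with hdly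
  set dry : ℚ := R.y1 - B.y1 with hdry
  set dlz : ℚ := B.z0 - R.z0 with hdlz
  set drz : ℚ := R.z1 - B.z1 with hdrz
  set px : Bool × Bool := dirPlanL ω.T ω.KL h dlx drx ω.xl ω.xr ω.kxl ω.kxr with hpx
  set py : Bool × Bool := dirPlanL ω.T ω.KL k dly dry ω.yl ω.yr ω.kyl ω.kyr with hpy
  set pz : Bool × Bool := dirPlanL ω.T ω.KL l dlz drz ω.zl ω.zr ω.kzl ω.kzr with hpz
  set G : BExpr3T := gexprL3 F ω R px.1 px.2 py.1 py.2 pz.1 pz.2 with hG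
  have h0 : 0 ≤ h := by rw [hh]; linarith
  have k0 : 0 ≤ k := by rw [hk]; linarith
  have l0 : 0 ≤ l := by rw [hl]; linarith
  have hSr : (0 : ℝ) < S := by exact_mod_cast hS
  have hTM := BExpr3T.tmem3_model hS h0 k0 l0 P cx cy cz G hacc
  obtain ⟨hXi, -, -⟩ := dirMomL_sound (dl := dlx) (dr := drx) (αl := ω.xl) (αr := ω.xr) (κl := ω.kxl)
    (κr := ω.kxr) (ml := px.1) (mr := px.2) hT h0 hdx
  obtain ⟨hYi, -, -⟩ := dirMomL_sound (dl := dly) (dr := dry) (αl := ω.yl) (αr := ω.yr) (κl := ω.kyl)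
    (κr := ω.kyr) (ml := py.1) (mr := py.2) hT k0 hdy
  obtain ⟨hZi, -, -⟩ := dirMomL_sound (dl := dlz) (dr := drz) (αl := ω.zl) (αr := ω.zr) (κl := ω.kzl)
    (κr := ω.kzr) (ml := pz.1) (mr := pz.2) hT l0 hdz
  set WX : ℝ → ℝ := dirWL h dlx drx ω.xl ω.xr ω.kxl ω.kxr px.1 px.2 with hWX
  set WY : ℝ → ℝ := dirWL k dly dry ω.yl ω.yr ω.kyl ω.kyr py.1 py.2 with hWY
  set WZ : ℝ → ℝ := dirWL l dlz drz ω.zl ω.zr ω.kzl ω.kzr pz.1 pz.2 with hWZ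
  -- the pointwise identity on the closed leaf
  have hcmx0 : cx - (dlx + h) = R.x0 := by rw [hcx, hh, hdlx]; ring
  have hcmx1 : cx + (drx + h) = R.x1 := by rw [hcx, hh, hdrx]; ring
  have hcmy0 : cy - (dly + k) = R.y0 := by rw [hcy, hk, hdly]; ring
  have hcmy1 : cy + (dry + k) = R.y1 := by rw [hcy, hk, hdry]; ring
  have hcmz0 : cz - (dlz + l) = R.z0 := by rw [hcz, hl, hdlz]; ring
  have hcmz1 : cz + (drz + l) = R.z1 := by rw [hcz, hl, hdrz]; ring
  have hpt : ∀ x : ℝ, (B.x0 : ℝ) ≤ x → x ≤ B.x1 → ∀ y : ℝ, (B.y0 : ℝ) ≤ y → y ≤ B.y1 →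
      ∀ z : ℝ, (B.z0 : ℝ) ≤ z → z ≤ B.z1 →
        wfunL3 ω R F x y z = WX (x - cx) * (WY (y - cy) * WZ (z - cz)) * G.toFun₃ x y z := by
    intro x hx0 hx1 y hy0 hy1 z hz0 hz1
    simp only [wfunL3, edgeWL, hWX, hWY, hWZ, dirWL, hG, toFun₃_gexprL3]
    rw [algLogW_left_split ω.kxl hcmx0 (sep_of_flagWL3' hsx0) hx0,
      algLogW_right_split ω.kxr hcmx1 (sep_of_flagWL3' hsx1) hx1,
      algLogW_left_split ω.kyl hcmy0 (sep_of_flagWL3' hsy0) hy0,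
      algLogW_right_split ω.kyr hcmy1 (sep_of_flagWL3' hsy1) hy1,
      algLogW_left_split ω.kzl hcmz0 (sep_of_flagWL3' hsz0) hz0,
      algLogW_right_split ω.kzr hcmz1 (sep_of_flagWL3' hsz1) hz1]
    ring
  have hxx : (B.x0 : ℝ) ≤ B.x1 := by exact_mod_cast hx
  have hyy : (B.y0 : ℝ) ≤ B.y1 := by exact_mod_cast hy
  have hzz : (B.z0 : ℝ) ≤ B.z1 := by exact_mod_cast hz
  have ex0 : -(h : ℝ) + (cx : ℝ) = (B.x0 : ℝ) := by rw [hcx, hh]; push_cast; ring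
  have ex1 : (h : ℝ) + (cx : ℝ) = (B.x1 : ℝ) := by rw [hcx, hh]; push_cast; ring
  have ey0 : -(k : ℝ) + (cy : ℝ) = (B.y0 : ℝ) := by rw [hcy, hk]; push_cast; ring
  have ey1 : (k : ℝ) + (cy : ℝ) = (B.y1 : ℝ) := by rw [hcy, hk]; push_cast; ring
  have ez0 : -(l : ℝ) + (cz : ℝ) = (B.z0 : ℝ) := by rw [hcz, hl]; push_cast; ring
  have ez1 : (l : ℝ) + (cz : ℝ) = (B.z1 : ℝ) := by rw [hcz, hl]; push_cast; ring
  -- the tensor weight is integrable on the closed leaf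
  have hIX : IntegrableOn (fun x : ℝ => WX (x - cx)) (Icc (B.x0 : ℝ) B.x1) volume := by
    have h1 := hXi.comp_sub_right (cx : ℝ)
    rw [ex0, ex1] at h1
    exact (intervalIntegrable_iff_integrableOn_Icc_of_le hxx).1 h1
  have hIY : IntegrableOn (fun y : ℝ => WY (y - cy)) (Icc (B.y0 : ℝ) B.y1) volume := by
    have h1 := hYi.comp_sub_right (cy : ℝ)
    rw [ey0, ey1] at h1
    exact (intervalIntegrable_iff_integrableOn_Icc_of_le hyy).1 h1
  have hIZ : IntegrableOn (fun z : ℝ => WZ (z - cz)) (Icc (B.z0 : ℝ) B.z1) volume := by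
    have h1 := hZi.comp_sub_right (cz : ℝ)
    rw [ez0, ez1] at h1
    exact (intervalIntegrable_iff_integrableOn_Icc_of_le hzz).1 h1
  have hIYZ : IntegrableOn (fun q : ℝ × ℝ => WY (q.1 - cy) * WZ (q.2 - cz))
      (Icc (B.y0 : ℝ) B.y1 ×ˢ Icc (B.z0 : ℝ) B.z1) volume := by
    have h1 := Integrable.mul_prod hIY hIZ
    rw [Measure.prod_restrict, ← Measure.volume_eq_prod] at h1
    exact h1
  have hIW : IntegrableOn (fun p : ℝ × ℝ × ℝ => WX (p.1 - cx) * (WY (p.2.1 - cy) * WZ (p.2.2 - cz)))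
      (Icc (B.x0 : ℝ) B.x1 ×ˢ (Icc (B.y0 : ℝ) B.y1 ×ˢ Icc (B.z0 : ℝ) B.z1)) volume := by
    have h1 := Integrable.mul_prod hIX hIYZ
    rw [Measure.prod_restrict, ← Measure.volume_eq_prod] at h1
    exact h1
  -- the regular part is jointly measurable and bounded on the closed leaf
  have hGm : AEStronglyMeasurable (fun p : ℝ × ℝ × ℝ => G.toFun₃ p.1 p.2.1 p.2.2)
      (volume.restrict (Icc (B.x0 : ℝ) B.x1 ×ˢ (Icc (B.y0 : ℝ) B.y1 ×ˢ Icc (B.z0 : ℝ) B.z1))) :=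
    (BExpr3T.measurable_toFun₃ G).aestronglyMeasurable
  have hGb : ∀ᵐ p : ℝ × ℝ × ℝ ∂(volume.restrict (Icc (B.x0 : ℝ) B.x1 ×ˢ (Icc (B.y0 : ℝ) B.y1 ×ˢ Icc (B.z0 : ℝ) B.z1))),
      ‖G.toFun₃ p.1 p.2.1 p.2.2‖ ≤ (tabs3 S h k l (BExpr3T.model S h k l P cx cy cz G).1 : ℝ) / S := by
    refine (ae_restrict_iff' (measurableSet_Icc.prod (measurableSet_Icc.prod measurableSet_Icc))).2
      (Filter.Eventually.of_forall fun p hp => ?_)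
    obtain ⟨⟨hp1, hp2⟩, ⟨hp3, hp4⟩, hp5, hp6⟩ := hp
    have hu : |p.1 - (cx : ℝ)| ≤ h := by rw [abs_le]; constructor <;> linarith
    have hv : |p.2.1 - (cy : ℝ)| ≤ k := by rw [abs_le]; constructor <;> linarith
    have hw : |p.2.2 - (cz : ℝ)| ≤ l := by rw [abs_le]; constructor <;> linarith
    rw [Real.norm_eq_abs, le_div_iff₀ hSr]
    have := abs_le_tabs3 h0 k0 l0 hTM hu hv hw
    simpa only [add_sub_cancel] using this
  have hI : IntegrableOn
      (fun p : ℝ × ℝ × ℝ => WX (p.1 - cx) * (WY (p.2.1 - cy) * WZ (p.2.2 - cz)) * G.toFun₃ p.1 p.2.1 p.2.2)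
      (Icc (B.x0 : ℝ) B.x1 ×ˢ (Icc (B.y0 : ℝ) B.y1 ×ˢ Icc (B.z0 : ℝ) B.z1)) volume := Integrable.mul_bdd hIW hGm hGb
  refine hI.congr_fun (fun p hp => ?_) (measurableSet_Icc.prod (measurableSet_Icc.prod measurableSet_Icc))
  obtain ⟨⟨hp1, hp2⟩, ⟨hp3, hp4⟩, hp5, hp6⟩ := hp
  exact (hpt p.1 hp1 hp2 p.2.1 hp3 hp4 p.2.2 hp5 hp6).symm

/-- **Joint integrability behind a checked 3-D tree, for an arbitrary leaf rule**: if every accepted leaf is jointly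
integrable on its closed box and correctly oriented, so is the root box (the leaves tile the box: structural
induction, splitting one interval of the product at the cut). [cite: MahboubiMelquiondSibutpinote2016, Sect. 3.3] -/
theorem tree3_integrableOn_rule {f : ℝ → ℝ → ℝ → ℝ} {Λ : Box3Q → EPrm → MI × Bool}
    (hΛ : ∀ (B : Box3Q) (P : EPrm), (Λ B P).2 = true →
      IntegrableOn (fun p : ℝ × ℝ × ℝ => f p.1 p.2.1 p.2.2)
          (Icc (B.x0 : ℝ) B.x1 ×ˢ (Icc (B.y0 : ℝ) B.y1 ×ˢ Icc (B.z0 : ℝ) B.z1)) volume ∧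
        B.x0 ≤ B.x1 ∧ B.y0 ≤ B.y1 ∧ B.z0 ≤ B.z1) :
    ∀ (t : KdTree3) (B : Box3Q), leafClaimsOK3R Λ (t.leaves B) = true →
      IntegrableOn (fun p : ℝ × ℝ × ℝ => f p.1 p.2.1 p.2.2)
          (Icc (B.x0 : ℝ) B.x1 ×ˢ (Icc (B.y0 : ℝ) B.y1 ×ˢ Icc (B.z0 : ℝ) B.z1)) volume ∧
        B.x0 ≤ B.x1 ∧ B.y0 ≤ B.y1 ∧ B.z0 ≤ B.z1
  | KdTree3.leaf P J, B, hok => by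
      simp only [KdTree3.leaves, leafClaimsOK3R, List.all_cons, List.all_nil, Bool.and_true, Bool.and_eq_true,
        decide_eq_true_eq] at hok
      exact hΛ B P hok.1.1
  | KdTree3.splitX c L R, B, hok => by
      simp only [KdTree3.leaves, leafClaimsOK3R, List.all_append, Bool.and_eq_true] at hok
      obtain ⟨hL, hxL, hyL, hzL⟩ :=
        tree3_integrableOn_rule hΛ L ⟨B.x0, c, B.y0, B.y1, B.z0, B.z1⟩ (by simpa [leafClaimsOK3R] using hok.1)
      obtain ⟨hR, hxR, hyR, hzR⟩ :=
        tree3_integrableOn_rule hΛ R ⟨c, B.x1, B.y0, B.y1, B.z0, B.z1⟩ (by simpa [leafClaimsOK3R] using hok.2)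
      simp only at hL hxL hyL hzL hR hxR hyR hzR
      refine ⟨?_, hxL.trans hxR, hyL, hzL⟩
      have e : (Icc (B.x0 : ℝ) B.x1 ×ˢ (Icc (B.y0 : ℝ) B.y1 ×ˢ Icc (B.z0 : ℝ) B.z1) : Set (ℝ × ℝ × ℝ)) =
          Icc (B.x0 : ℝ) c ×ˢ (Icc (B.y0 : ℝ) B.y1 ×ˢ Icc (B.z0 : ℝ) B.z1) ∪
            Icc (c : ℝ) B.x1 ×ˢ (Icc (B.y0 : ℝ) B.y1 ×ˢ Icc (B.z0 : ℝ) B.z1) := by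
        rw [← union_prod, Icc_union_Icc_eq_Icc (by exact_mod_cast hxL) (by exact_mod_cast hxR)]
      rw [e]
      exact hL.union hR
  | KdTree3.splitY c L R, B, hok => by
      simp only [KdTree3.leaves, leafClaimsOK3R, List.all_append, Bool.and_eq_true] at hok
      obtain ⟨hL, hxL, hyL, hzL⟩ :=
        tree3_integrableOn_rule hΛ L ⟨B.x0, B.x1, B.y0, c, B.z0, B.z1⟩ (by simpa [leafClaimsOK3R] using hok.1)
      obtain ⟨hR, hxR, hyR, hzR⟩ :=
        tree3_integrableOn_rule hΛ R ⟨B.x0, B.x1, c, B.y1, B.z0, B.z1⟩ (by simpa [leafClaimsOK3R] using hok.2)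
      simp only at hL hxL hyL hzL hR hxR hyR hzR
      refine ⟨?_, hxL, hyL.trans hyR, hzL⟩
      have e : (Icc (B.x0 : ℝ) B.x1 ×ˢ (Icc (B.y0 : ℝ) B.y1 ×ˢ Icc (B.z0 : ℝ) B.z1) : Set (ℝ × ℝ × ℝ)) =
          Icc (B.x0 : ℝ) B.x1 ×ˢ (Icc (B.y0 : ℝ) c ×ˢ Icc (B.z0 : ℝ) B.z1) ∪
            Icc (B.x0 : ℝ) B.x1 ×ˢ (Icc (c : ℝ) B.y1 ×ˢ Icc (B.z0 : ℝ) B.z1) := by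
        rw [← prod_union, ← union_prod, Icc_union_Icc_eq_Icc (by exact_mod_cast hyL) (by exact_mod_cast hyR)]
      rw [e]
      exact hL.union hR
  | KdTree3.splitZ c L R, B, hok => by
      simp only [KdTree3.leaves, leafClaimsOK3R, List.all_append, Bool.and_eq_true] at hok
      obtain ⟨hL, hxL, hyL, hzL⟩ :=
        tree3_integrableOn_rule hΛ L ⟨B.x0, B.x1, B.y0, B.y1, B.z0, c⟩ (by simpa [leafClaimsOK3R] using hok.1)
      obtain ⟨hR, hxR, hyR, hzR⟩ :=
        tree3_integrableOn_rule hΛ R ⟨B.x0, B.x1, B.y0, B.y1, c, B.z1⟩ (by simpa [leafClaimsOK3R] using hok.2)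
      simp only at hL hxL hyL hzL hR hxR hyR hzR
      refine ⟨?_, hxL, hyL, hzL.trans hzR⟩
      have e : (Icc (B.x0 : ℝ) B.x1 ×ˢ (Icc (B.y0 : ℝ) B.y1 ×ˢ Icc (B.z0 : ℝ) B.z1) : Set (ℝ × ℝ × ℝ)) =
          Icc (B.x0 : ℝ) B.x1 ×ˢ (Icc (B.y0 : ℝ) B.y1 ×ˢ Icc (B.z0 : ℝ) c) ∪
            Icc (B.x0 : ℝ) B.x1 ×ˢ (Icc (B.y0 : ℝ) B.y1 ×ˢ Icc (c : ℝ) B.z1) := by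
        rw [← prod_union, ← prod_union, Icc_union_Icc_eq_Icc (by exact_mod_cast hzL) (by exact_mod_cast hzR)]
      rw [e]
      exact hL.union hR

/-- [folklore] -/
private theorem leafClaimsOK3R_of_leafCheck3R' (Λ : Box3Q → EPrm → MI × Bool) (t : KdTree3) (B : Box3Q) {n : ℕ}
    (hn : t.size ≤ n) (H : ∀ i : ℕ, i < n → leafCheck3R Λ t B i = true) : leafClaimsOK3R Λ (t.leaves B) = true := by
  unfold leafClaimsOK3R
  refine List.all_eq_true.2 fun l hl => ?_
  obtain ⟨i, hi, rfl⟩ := List.getElem_of_mem hl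
  have hlt : i < n := lt_of_lt_of_le (by simpa [KdTree3.length_leaves] using hi) hn
  have := H i hlt
  simp only [leafCheck3R, List.getElem?_eq_getElem hi] at this
  exact this

/-- **What a checked face-weighted certificate provides beyond the enclosure**: the weighted integrand is (jointly)
integrable on the closed root box `[x0, x1] × [y0, y1] × [z0, z1]`, and the box is correctly oriented.
[cite: DavisRabinowitz1984, Sect. 2.12.5] [cite: MahboubiMelquiondSibutpinote2016, Sect. 3.3] -/
theorem integrableOn_wfunL3_of_leafCheckWL3 {S : ℕ} {F : BExpr3T} {ω : WLPrm3} {R : Box3Q} {t : KdTree3} {n : ℕ}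
    {lo hi : ℚ} (hleaf : ∀ i : ℕ, i < n → leafCheckWL3 S F ω R t i = true)
    (ht : treeCheckWL3 S t n lo hi = true) :
    IntegrableOn (fun p : ℝ × ℝ × ℝ => wfunL3 ω R F p.1 p.2.1 p.2.2)
        (Icc (R.x0 : ℝ) R.x1 ×ˢ (Icc (R.y0 : ℝ) R.y1 ×ˢ Icc (R.z0 : ℝ) R.z1)) volume ∧
      R.x0 ≤ R.x1 ∧ R.y0 ≤ R.y1 ∧ R.z0 ≤ R.z1 := by
  unfold treeCheckWL3 treeCheckG3 at ht
  simp only [Bool.and_eq_true, decide_eq_true_eq] at ht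
  obtain ⟨⟨⟨hS, hn⟩, -⟩, -⟩ := ht
  exact tree3_integrableOn_rule (Λ := leafEnclWL3 S F ω R)
    (fun B P hok => ⟨integrableOn_prod_of_leafEnclWL3 hS F ω R B P hok,
      (leafEnclWL3_sound hS F ω R B P hok).2.2.2.2⟩) t R (leafClaimsOK3R_of_leafCheck3R' _ t R hn hleaf)

/-- **Fubini on a closed 3-D box** (the form used downstream): for a jointly integrable `f` on
`[a, b] × [c, d] × [e, g]` the iterated interval integral is the integral over the box for Lebesgue measure
(product rules over the cube, op. cit.). [cite: DavisRabinowitz1984, Sect. 5.6] -/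
theorem intervalIntegral_iterated3_eq_setIntegral_prod {f : ℝ → ℝ → ℝ → ℝ} {a b c d e g : ℝ} (hab : a ≤ b)
    (hcd : c ≤ d) (heg : e ≤ g)
    (hf : IntegrableOn (fun p : ℝ × ℝ × ℝ => f p.1 p.2.1 p.2.2) (Icc a b ×ˢ (Icc c d ×ˢ Icc e g)) volume) :
    ∫ x in a..b, ∫ y in c..d, ∫ z in e..g, f x y z = ∫ p in Icc a b ×ˢ (Icc c d ×ˢ Icc e g), f p.1 p.2.1 p.2.2 := by
  have hf' : Integrable (fun p : ℝ × ℝ × ℝ => f p.1 p.2.1 p.2.2)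
      ((volume.restrict (Icc a b)).prod (volume.restrict (Icc c d ×ˢ Icc e g))) := by
    rw [Measure.prod_restrict, ← Measure.volume_eq_prod]; exact hf
  have hae := hf'.prod_right_ae
  have hf'' : IntegrableOn (fun p : ℝ × ℝ × ℝ => f p.1 p.2.1 p.2.2) (Icc a b ×ˢ (Icc c d ×ˢ Icc e g))
      ((volume : Measure ℝ).prod (volume : Measure (ℝ × ℝ))) := by
    rw [← Measure.volume_eq_prod]; exact hf
  calc ∫ x in a..b, ∫ y in c..d, ∫ z in e..g, f x y z
      = ∫ x in Icc a b, ∫ y in c..d, ∫ z in e..g, f x y z := by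
        rw [intervalIntegral.integral_of_le hab, integral_Icc_eq_integral_Ioc]
    _ = ∫ x in Icc a b, ∫ q in Icc c d ×ˢ Icc e g, f x q.1 q.2 := by
        refine integral_congr_ae (hae.mono fun x hx => ?_)
        exact intervalIntegral_iterated_eq_setIntegral_prod hcd heg hx
    _ = ∫ p in Icc a b ×ˢ (Icc c d ×ˢ Icc e g), f p.1 p.2.1 p.2.2 := by
        rw [Measure.volume_eq_prod (α := ℝ) (β := ℝ × ℝ), setIntegral_prod _ hf'']

/-! ### Part B. Duffy's transformation of a box onto its three pyramids, as identities of set integrals -/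

/-- [folklore] Lebesgue measure on `ℝ × ℝ × ℝ` is an additive Haar measure (instance path through the iterated
product). -/
private instance volume_prod3_isAddHaarMeasure : (volume : Measure (ℝ × ℝ × ℝ)).IsAddHaarMeasure := by
  rw [Measure.volume_eq_prod]; infer_instance

/-- Linear coordinates `ℝ × ℝ × ℝ ≃ (Fin 3 → ℝ)` (to compute Jacobian determinants as `3 × 3` determinants).
[cite: MousaviSukumar2009, Appendix A] -/
def coord3 : (ℝ × ℝ × ℝ) ≃ₗ[ℝ] (Fin 3 → ℝ) where
  toFun p := ![p.1, p.2.1, p.2.2]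
  invFun v := (v 0, v 1, v 2)
  map_add' p q := by ext i; fin_cases i <;> simp
  map_smul' c p := by ext i; fin_cases i <;> simp
  left_inv p := by rfl
  right_inv v := by ext i; fin_cases i <;> rfl

/-- The determinant of a linear map of `ℝ × ℝ × ℝ` is the `3 × 3` determinant of its matrix in coordinates.
[cite: MousaviSukumar2009, Appendix A] -/
theorem det_eq_det_toMatrix3 (A : (ℝ × ℝ × ℝ) →L[ℝ] ℝ × ℝ × ℝ) :
    A.det = (LinearMap.toMatrix' (coord3.toLinearMap ∘ₗ (A : (ℝ × ℝ × ℝ) →ₗ[ℝ] ℝ × ℝ × ℝ) ∘ₗ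
      coord3.symm.toLinearMap)).det := by
  rw [LinearMap.det_toMatrix', ContinuousLinearMap.det]
  exact (LinearMap.det_conj (A : (ℝ × ℝ × ℝ) →ₗ[ℝ] ℝ × ℝ × ℝ) coord3).symm

/-- **Duffy's map onto the `x`-pyramid** of the box with singular vertex `(x0, y0, z0)`:
`(x, s, t) ↦ (x, y0 + κ (x − x0) s, z0 + κ' (x − x0) t)` (op. cit.: the cube is divided into pyramids with apex at
the singular vertex and each pyramid is mapped onto a cube; `x = u`, `y = u v`, `z = u w`, translated and scaled).
[cite: Duffy1982, p. 1260] [cite: MousaviSukumar2009, Appendix A] -/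
def duffy3X (κ κ' x0 y0 z0 : ℝ) (p : ℝ × ℝ × ℝ) : ℝ × ℝ × ℝ :=
  (p.1, y0 + κ * (p.1 - x0) * p.2.1, z0 + κ' * (p.1 - x0) * p.2.2)

/-- The derivative of `duffy3X` at `p = (x, s, t)`: `v ↦ (v₁, κ s v₁ + κ (x − x0) v₂, κ' t v₁ + κ' (x − x0) v₃)`.
[cite: MousaviSukumar2009, Appendix A] -/
noncomputable def fderivDuffy3X (κ κ' x0 : ℝ) (p : ℝ × ℝ × ℝ) : (ℝ × ℝ × ℝ) →L[ℝ] ℝ × ℝ × ℝ :=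
  (ContinuousLinearMap.fst ℝ ℝ (ℝ × ℝ)).prod
    (((κ * p.2.1) • ContinuousLinearMap.fst ℝ ℝ (ℝ × ℝ) +
        (κ * (p.1 - x0)) • ((ContinuousLinearMap.fst ℝ ℝ ℝ).comp (ContinuousLinearMap.snd ℝ ℝ (ℝ × ℝ)))).prod
      ((κ' * p.2.2) • ContinuousLinearMap.fst ℝ ℝ (ℝ × ℝ) +
        (κ' * (p.1 - x0)) • ((ContinuousLinearMap.snd ℝ ℝ ℝ).comp (ContinuousLinearMap.snd ℝ ℝ (ℝ × ℝ)))))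

/-- The derivative as an explicit linear map of `ℝ × ℝ × ℝ`. [cite: MousaviSukumar2009, Appendix A] -/
@[simp] theorem fderivDuffy3X_apply (κ κ' x0 : ℝ) (p v : ℝ × ℝ × ℝ) :
    fderivDuffy3X κ κ' x0 p v =
      (v.1, κ * p.2.1 * v.1 + κ * (p.1 - x0) * v.2.1, κ' * p.2.2 * v.1 + κ' * (p.1 - x0) * v.2.2) := by
  simp [fderivDuffy3X]

/-- [cite: MousaviSukumar2009, Appendix A] -/
theorem hasFDerivAt_duffy3X (κ κ' x0 y0 z0 : ℝ) (p : ℝ × ℝ × ℝ) :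
    HasFDerivAt (duffy3X κ κ' x0 y0 z0) (fderivDuffy3X κ κ' x0 p) p := by
  have h1 : HasFDerivAt (fun q : ℝ × ℝ × ℝ => q.1) (ContinuousLinearMap.fst ℝ ℝ (ℝ × ℝ)) p := hasFDerivAt_fst
  have h2 : HasFDerivAt (fun q : ℝ × ℝ × ℝ => q.2.1)
      ((ContinuousLinearMap.fst ℝ ℝ ℝ).comp (ContinuousLinearMap.snd ℝ ℝ (ℝ × ℝ))) p := hasFDerivAt_snd.fst
  have h3 : HasFDerivAt (fun q : ℝ × ℝ × ℝ => q.2.2)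
      ((ContinuousLinearMap.snd ℝ ℝ ℝ).comp (ContinuousLinearMap.snd ℝ ℝ (ℝ × ℝ))) p := hasFDerivAt_snd.snd
  have h := h1.prodMk (((((h1.sub_const x0).const_mul κ).mul h2).const_add y0).prodMk
    ((((h1.sub_const x0).const_mul κ').mul h3).const_add z0))
  refine h.congr_fderiv (ContinuousLinearMap.ext fun v => ?_)
  rw [fderivDuffy3X_apply]
  simp only [ContinuousLinearMap.prod_apply, FunLike.coe_add, FunLike.coe_smul, Pi.add_apply,
    Pi.smul_apply,
    ContinuousLinearMap.coe_fst', ContinuousLinearMap.coe_snd', ContinuousLinearMap.coe_comp,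
    Function.comp_apply, smul_eq_mul, Prod.mk.injEq]
  refine ⟨trivial, ?_, ?_⟩ <;> ring

/-- The Jacobian determinant of the `x`-pyramid map: `κ κ' (x − x0)²` (op. cit.: `J = u²`).
[cite: Duffy1982, p. 1260] [cite: MousaviSukumar2009, Appendix A] -/
theorem det_fderivDuffy3X (κ κ' x0 : ℝ) (p : ℝ × ℝ × ℝ) :
    (fderivDuffy3X κ κ' x0 p).det = κ * κ' * (p.1 - x0) ^ 2 := by
  rw [det_eq_det_toMatrix3, Matrix.det_fin_three]
  simp [LinearMap.toMatrix'_apply, coord3]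
  ring

/-- The `x`-pyramid map is injective off the face `x = x0` (`κ, κ' > 0`). [cite: Duffy1982, p. 1260] -/
theorem injOn_duffy3X {κ κ' : ℝ} (hκ : 0 < κ) (hκ' : 0 < κ') (x0 y0 z0 : ℝ) (t : Set (ℝ × ℝ)) :
    InjOn (duffy3X κ κ' x0 y0 z0) (Ioi x0 ×ˢ t) := by
  intro p hp q hq hpq
  rw [Set.mem_prod, Set.mem_Ioi] at hp
  simp only [duffy3X, Prod.mk.injEq] at hpq
  obtain ⟨h1, h2, h3⟩ := hpq
  have hpos : 0 < κ * (p.1 - x0) := mul_pos hκ (sub_pos.2 hp.1)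
  have hpos' : 0 < κ' * (p.1 - x0) := mul_pos hκ' (sub_pos.2 hp.1)
  rw [← h1] at h2 h3
  have h4 : κ * (p.1 - x0) * p.2.1 = κ * (p.1 - x0) * q.2.1 := by linarith
  have h5 : κ' * (p.1 - x0) * p.2.2 = κ' * (p.1 - x0) * q.2.2 := by linarith
  exact Prod.ext h1 (Prod.ext (mul_left_cancel₀ hpos.ne' h4) (mul_left_cancel₀ hpos'.ne' h5))

/-- **The image of the `x`-pyramid map** on `(x0, x1] × [0, 1] × [0, 1]` is the pyramid
`{x0 < x ≤ x1, y0 ≤ y ≤ y0 + κ (x − x0), z0 ≤ z ≤ z0 + κ' (x − x0)}` (closed along its slanted faces).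
[cite: Duffy1982, p. 1260] -/
theorem image_duffy3X {κ κ' : ℝ} (hκ : 0 < κ) (hκ' : 0 < κ') (x0 x1 y0 z0 : ℝ) :
    duffy3X κ κ' x0 y0 z0 '' (Ioc x0 x1 ×ˢ (Icc 0 1 ×ˢ Icc 0 1)) =
      {p : ℝ × ℝ × ℝ | x0 < p.1 ∧ p.1 ≤ x1 ∧ y0 ≤ p.2.1 ∧ p.2.1 ≤ y0 + κ * (p.1 - x0) ∧
        z0 ≤ p.2.2 ∧ p.2.2 ≤ z0 + κ' * (p.1 - x0)} := by
  ext p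
  simp only [Set.mem_image, Set.mem_prod, Set.mem_Ioc, Set.mem_Icc, Set.mem_setOf_eq]
  constructor
  · rintro ⟨q, ⟨⟨hq1, hq2⟩, ⟨hq3, hq4⟩, hq5, hq6⟩, rfl⟩
    have hpos : 0 < κ * (q.1 - x0) := mul_pos hκ (sub_pos.2 hq1)
    have hpos' : 0 < κ' * (q.1 - x0) := mul_pos hκ' (sub_pos.2 hq1)
    refine ⟨hq1, hq2, ?_, ?_, ?_, ?_⟩
    · show y0 ≤ y0 + κ * (q.1 - x0) * q.2.1
      nlinarith
    · show y0 + κ * (q.1 - x0) * q.2.1 ≤ y0 + κ * (q.1 - x0)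
      nlinarith
    · show z0 ≤ z0 + κ' * (q.1 - x0) * q.2.2
      nlinarith
    · show z0 + κ' * (q.1 - x0) * q.2.2 ≤ z0 + κ' * (q.1 - x0)
      nlinarith
  · rintro ⟨h1, h2, h3, h4, h5, h6⟩
    have hpos : 0 < κ * (p.1 - x0) := mul_pos hκ (sub_pos.2 h1)
    have hpos' : 0 < κ' * (p.1 - x0) := mul_pos hκ' (sub_pos.2 h1)
    refine ⟨(p.1, (p.2.1 - y0) / (κ * (p.1 - x0)), (p.2.2 - z0) / (κ' * (p.1 - x0))),
      ⟨⟨h1, h2⟩, ⟨div_nonneg (by linarith) hpos.le, ?_⟩, div_nonneg (by linarith) hpos'.le, ?_⟩, ?_⟩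
    · rw [div_le_one hpos]; linarith
    · rw [div_le_one hpos']; linarith
    · simp only [duffy3X]
      rw [mul_div_cancel₀ _ hpos.ne', mul_div_cancel₀ _ hpos'.ne']
      ext <;> simp

/-- [folklore] -/
private theorem Ioc_prod_Icc_prod_Icc_ae_eq (a b c d e g : ℝ) :
    (Ioc a b ×ˢ (Icc c d ×ˢ Icc e g) : Set (ℝ × ℝ × ℝ)) =ᵐ[volume] (Icc a b ×ˢ (Icc c d ×ˢ Icc e g) : Set (ℝ × ℝ × ℝ)) := by
  rw [Measure.volume_eq_prod]
  exact Measure.set_prod_ae_eq Ioc_ae_eq_Icc (Filter.EventuallyEq.refl _ _)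

/-- **Duffy's substitution on the `x`-pyramid** (no hypothesis on `f`):
`∫_{P_X} f = ∫_{[x0,x1]×[0,1]²} κ κ' (x − x0)² · f(x, y0 + κ (x − x0) s, z0 + κ' (x − x0) t)` and `f` is integrable on
`P_X` iff the transformed integrand is integrable on the closed box. [cite: Duffy1982, p. 1260]
[cite: MousaviSukumar2009, Appendix A] -/
theorem setIntegral_duffy3X {κ κ' : ℝ} (hκ : 0 < κ) (hκ' : 0 < κ') (x0 x1 y0 z0 : ℝ) (f : ℝ × ℝ × ℝ → ℝ) :
    (∫ p in {p : ℝ × ℝ × ℝ | x0 < p.1 ∧ p.1 ≤ x1 ∧ y0 ≤ p.2.1 ∧ p.2.1 ≤ y0 + κ * (p.1 - x0) ∧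
        z0 ≤ p.2.2 ∧ p.2.2 ≤ z0 + κ' * (p.1 - x0)}, f p =
        ∫ p in Icc x0 x1 ×ˢ (Icc (0 : ℝ) 1 ×ˢ Icc (0 : ℝ) 1),
          κ * κ' * (p.1 - x0) ^ 2 * f (p.1, y0 + κ * (p.1 - x0) * p.2.1, z0 + κ' * (p.1 - x0) * p.2.2)) ∧
      (IntegrableOn f {p : ℝ × ℝ × ℝ | x0 < p.1 ∧ p.1 ≤ x1 ∧ y0 ≤ p.2.1 ∧ p.2.1 ≤ y0 + κ * (p.1 - x0) ∧
          z0 ≤ p.2.2 ∧ p.2.2 ≤ z0 + κ' * (p.1 - x0)} volume ↔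
        IntegrableOn (fun p : ℝ × ℝ × ℝ =>
            κ * κ' * (p.1 - x0) ^ 2 * f (p.1, y0 + κ * (p.1 - x0) * p.2.1, z0 + κ' * (p.1 - x0) * p.2.2))
          (Icc x0 x1 ×ˢ (Icc (0 : ℝ) 1 ×ˢ Icc (0 : ℝ) 1)) volume) := by
  have hs : MeasurableSet (Ioc x0 x1 ×ˢ (Icc (0 : ℝ) 1 ×ˢ Icc (0 : ℝ) 1) : Set (ℝ × ℝ × ℝ)) :=
    measurableSet_Ioc.prod (measurableSet_Icc.prod measurableSet_Icc)
  have hf' : ∀ p ∈ (Ioc x0 x1 ×ˢ (Icc (0 : ℝ) 1 ×ˢ Icc (0 : ℝ) 1) : Set (ℝ × ℝ × ℝ)),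
      HasFDerivWithinAt (duffy3X κ κ' x0 y0 z0) (fderivDuffy3X κ κ' x0 p)
        (Ioc x0 x1 ×ˢ (Icc (0 : ℝ) 1 ×ˢ Icc (0 : ℝ) 1)) p :=
    fun p _ => (hasFDerivAt_duffy3X κ κ' x0 y0 z0 p).hasFDerivWithinAt
  have hinj : InjOn (duffy3X κ κ' x0 y0 z0) (Ioc x0 x1 ×ˢ (Icc (0 : ℝ) 1 ×ˢ Icc (0 : ℝ) 1)) :=
    (injOn_duffy3X hκ hκ' x0 y0 z0 (Icc 0 1 ×ˢ Icc 0 1)).mono (prod_mono Ioc_subset_Ioi_self Subset.rfl)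
  have heqOn : EqOn (fun p : ℝ × ℝ × ℝ => |(fderivDuffy3X κ κ' x0 p).det| • f (duffy3X κ κ' x0 y0 z0 p))
      (fun p : ℝ × ℝ × ℝ =>
        κ * κ' * (p.1 - x0) ^ 2 * f (p.1, y0 + κ * (p.1 - x0) * p.2.1, z0 + κ' * (p.1 - x0) * p.2.2))
      (Ioc x0 x1 ×ˢ (Icc (0 : ℝ) 1 ×ˢ Icc (0 : ℝ) 1)) := by
    intro p _
    simp only [det_fderivDuffy3X, smul_eq_mul, duffy3X]
    rw [abs_of_nonneg (mul_nonneg (mul_nonneg hκ.le hκ'.le) (sq_nonneg _))]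
  rw [← image_duffy3X hκ hκ' x0 x1 y0 z0]
  constructor
  · rw [integral_image_eq_integral_abs_det_fderiv_smul volume hs hf' hinj f, setIntegral_congr_fun hs heqOn,
      setIntegral_congr_set (Ioc_prod_Icc_prod_Icc_ae_eq x0 x1 0 1 0 1)]
  · rw [integrableOn_image_iff_integrableOn_abs_det_fderiv_smul volume hs hf' hinj f,
      integrableOn_congr_fun heqOn hs]
    exact ⟨fun h => h.congr_set_ae (Ioc_prod_Icc_prod_Icc_ae_eq x0 x1 0 1 0 1).symm,
      fun h => h.congr_set_ae (Ioc_prod_Icc_prod_Icc_ae_eq x0 x1 0 1 0 1)⟩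

/-- **Duffy's map onto the `y`-pyramid** (outer variable `y`): `(y, s, t) ↦ (x0 + κ (y − y0) s, y, z0 + κ' (y − y0) t)`.
[cite: Duffy1982, p. 1260] [cite: MousaviSukumar2009, Appendix A] -/
def duffy3Y (κ κ' x0 y0 z0 : ℝ) (p : ℝ × ℝ × ℝ) : ℝ × ℝ × ℝ :=
  (x0 + κ * (p.1 - y0) * p.2.1, p.1, z0 + κ' * (p.1 - y0) * p.2.2)

/-- The derivative of `duffy3Y` at `p = (y, s, t)`. [cite: MousaviSukumar2009, Appendix A] -/
noncomputable def fderivDuffy3Y (κ κ' y0 : ℝ) (p : ℝ × ℝ × ℝ) : (ℝ × ℝ × ℝ) →L[ℝ] ℝ × ℝ × ℝ :=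
  (((κ * p.2.1) • ContinuousLinearMap.fst ℝ ℝ (ℝ × ℝ) +
      (κ * (p.1 - y0)) • ((ContinuousLinearMap.fst ℝ ℝ ℝ).comp (ContinuousLinearMap.snd ℝ ℝ (ℝ × ℝ))))).prod
    ((ContinuousLinearMap.fst ℝ ℝ (ℝ × ℝ)).prod
      ((κ' * p.2.2) • ContinuousLinearMap.fst ℝ ℝ (ℝ × ℝ) +
        (κ' * (p.1 - y0)) • ((ContinuousLinearMap.snd ℝ ℝ ℝ).comp (ContinuousLinearMap.snd ℝ ℝ (ℝ × ℝ)))))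

/-- The derivative as an explicit linear map of `ℝ × ℝ × ℝ`. [cite: MousaviSukumar2009, Appendix A] -/
@[simp] theorem fderivDuffy3Y_apply (κ κ' y0 : ℝ) (p v : ℝ × ℝ × ℝ) :
    fderivDuffy3Y κ κ' y0 p v =
      (κ * p.2.1 * v.1 + κ * (p.1 - y0) * v.2.1, v.1, κ' * p.2.2 * v.1 + κ' * (p.1 - y0) * v.2.2) := by
  simp [fderivDuffy3Y]

/-- [cite: MousaviSukumar2009, Appendix A] -/
theorem hasFDerivAt_duffy3Y (κ κ' x0 y0 z0 : ℝ) (p : ℝ × ℝ × ℝ) :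
    HasFDerivAt (duffy3Y κ κ' x0 y0 z0) (fderivDuffy3Y κ κ' y0 p) p := by
  have h1 : HasFDerivAt (fun q : ℝ × ℝ × ℝ => q.1) (ContinuousLinearMap.fst ℝ ℝ (ℝ × ℝ)) p := hasFDerivAt_fst
  have h2 : HasFDerivAt (fun q : ℝ × ℝ × ℝ => q.2.1)
      ((ContinuousLinearMap.fst ℝ ℝ ℝ).comp (ContinuousLinearMap.snd ℝ ℝ (ℝ × ℝ))) p := hasFDerivAt_snd.fst
  have h3 : HasFDerivAt (fun q : ℝ × ℝ × ℝ => q.2.2)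
      ((ContinuousLinearMap.snd ℝ ℝ ℝ).comp (ContinuousLinearMap.snd ℝ ℝ (ℝ × ℝ))) p := hasFDerivAt_snd.snd
  have h := ((((h1.sub_const y0).const_mul κ).mul h2).const_add x0).prodMk (h1.prodMk
    ((((h1.sub_const y0).const_mul κ').mul h3).const_add z0))
  refine h.congr_fderiv (ContinuousLinearMap.ext fun v => ?_)
  rw [fderivDuffy3Y_apply]
  simp only [ContinuousLinearMap.prod_apply, FunLike.coe_add, FunLike.coe_smul, Pi.add_apply,
    Pi.smul_apply,
    ContinuousLinearMap.coe_fst', ContinuousLinearMap.coe_snd', ContinuousLinearMap.coe_comp,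
    Function.comp_apply, smul_eq_mul, Prod.mk.injEq]
  refine ⟨?_, trivial, ?_⟩ <;> ring

/-- The Jacobian determinant of the `y`-pyramid map: `−κ κ' (y − y0)²`. [cite: MousaviSukumar2009, Appendix A] -/
theorem det_fderivDuffy3Y (κ κ' y0 : ℝ) (p : ℝ × ℝ × ℝ) :
    (fderivDuffy3Y κ κ' y0 p).det = -(κ * κ' * (p.1 - y0) ^ 2) := by
  rw [det_eq_det_toMatrix3, Matrix.det_fin_three]
  simp [LinearMap.toMatrix'_apply, coord3]
  ring

/-- The `y`-pyramid map is injective off the face `y = y0`. [cite: Duffy1982, p. 1260] -/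
theorem injOn_duffy3Y {κ κ' : ℝ} (hκ : 0 < κ) (hκ' : 0 < κ') (x0 y0 z0 : ℝ) (t : Set (ℝ × ℝ)) :
    InjOn (duffy3Y κ κ' x0 y0 z0) (Ioi y0 ×ˢ t) := by
  intro p hp q hq hpq
  rw [Set.mem_prod, Set.mem_Ioi] at hp
  simp only [duffy3Y, Prod.mk.injEq] at hpq
  obtain ⟨h2, h1, h3⟩ := hpq
  have hpos : 0 < κ * (p.1 - y0) := mul_pos hκ (sub_pos.2 hp.1)
  have hpos' : 0 < κ' * (p.1 - y0) := mul_pos hκ' (sub_pos.2 hp.1)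
  rw [← h1] at h2 h3
  have h4 : κ * (p.1 - y0) * p.2.1 = κ * (p.1 - y0) * q.2.1 := by linarith
  have h5 : κ' * (p.1 - y0) * p.2.2 = κ' * (p.1 - y0) * q.2.2 := by linarith
  exact Prod.ext h1 (Prod.ext (mul_left_cancel₀ hpos.ne' h4) (mul_left_cancel₀ hpos'.ne' h5))

/-- **The image of the `y`-pyramid map** on `(y0, y1] × [0, 1) × [0, 1]` is the pyramid
`{y0 < y ≤ y1, x0 ≤ x < x0 + κ (y − y0), z0 ≤ z ≤ z0 + κ' (y − y0)}` (open towards the `x`-pyramid).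
[cite: Duffy1982, p. 1260] -/
theorem image_duffy3Y {κ κ' : ℝ} (hκ : 0 < κ) (hκ' : 0 < κ') (x0 y0 y1 z0 : ℝ) :
    duffy3Y κ κ' x0 y0 z0 '' (Ioc y0 y1 ×ˢ (Ico 0 1 ×ˢ Icc 0 1)) =
      {p : ℝ × ℝ × ℝ | y0 < p.2.1 ∧ p.2.1 ≤ y1 ∧ x0 ≤ p.1 ∧ p.1 < x0 + κ * (p.2.1 - y0) ∧
        z0 ≤ p.2.2 ∧ p.2.2 ≤ z0 + κ' * (p.2.1 - y0)} := by
  ext p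
  simp only [Set.mem_image, Set.mem_prod, Set.mem_Ioc, Set.mem_Ico, Set.mem_Icc, Set.mem_setOf_eq]
  constructor
  · rintro ⟨q, ⟨⟨hq1, hq2⟩, ⟨hq3, hq4⟩, hq5, hq6⟩, rfl⟩
    have hpos : 0 < κ * (q.1 - y0) := mul_pos hκ (sub_pos.2 hq1)
    have hpos' : 0 < κ' * (q.1 - y0) := mul_pos hκ' (sub_pos.2 hq1)
    refine ⟨hq1, hq2, ?_, ?_, ?_, ?_⟩
    · show x0 ≤ x0 + κ * (q.1 - y0) * q.2.1
      nlinarith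
    · show x0 + κ * (q.1 - y0) * q.2.1 < x0 + κ * (q.1 - y0)
      nlinarith
    · show z0 ≤ z0 + κ' * (q.1 - y0) * q.2.2
      nlinarith
    · show z0 + κ' * (q.1 - y0) * q.2.2 ≤ z0 + κ' * (q.1 - y0)
      nlinarith
  · rintro ⟨h1, h2, h3, h4, h5, h6⟩
    have hpos : 0 < κ * (p.2.1 - y0) := mul_pos hκ (sub_pos.2 h1)
    have hpos' : 0 < κ' * (p.2.1 - y0) := mul_pos hκ' (sub_pos.2 h1)
    refine ⟨(p.2.1, (p.1 - x0) / (κ * (p.2.1 - y0)), (p.2.2 - z0) / (κ' * (p.2.1 - y0))),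
      ⟨⟨h1, h2⟩, ⟨div_nonneg (by linarith) hpos.le, ?_⟩, div_nonneg (by linarith) hpos'.le, ?_⟩, ?_⟩
    · rw [div_lt_one hpos]; linarith
    · rw [div_le_one hpos']; linarith
    · simp only [duffy3Y]
      rw [mul_div_cancel₀ _ hpos.ne', mul_div_cancel₀ _ hpos'.ne']
      ext <;> simp

/-- [folklore] -/
private theorem Ico_prod_Icc_ae_eq2 (c d e g : ℝ) :
    (Ico c d ×ˢ Icc e g : Set (ℝ × ℝ)) =ᵐ[volume] (Icc c d ×ˢ Icc e g : Set (ℝ × ℝ)) := by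
  rw [Measure.volume_eq_prod]
  exact Measure.set_prod_ae_eq Ico_ae_eq_Icc (Filter.EventuallyEq.refl _ _)

/-- [folklore] -/
private theorem Ioc_prod_Ico_prod_Icc_ae_eq (a b c d e g : ℝ) :
    (Ioc a b ×ˢ (Ico c d ×ˢ Icc e g) : Set (ℝ × ℝ × ℝ)) =ᵐ[volume] (Icc a b ×ˢ (Icc c d ×ˢ Icc e g) : Set (ℝ × ℝ × ℝ)) := by
  rw [Measure.volume_eq_prod]
  exact Measure.set_prod_ae_eq Ioc_ae_eq_Icc (Ico_prod_Icc_ae_eq2 c d e g)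

/-- **Duffy's substitution on the `y`-pyramid** (no hypothesis on `f`), with the transfer of integrability.
[cite: Duffy1982, p. 1260] [cite: MousaviSukumar2009, Appendix A] -/
theorem setIntegral_duffy3Y {κ κ' : ℝ} (hκ : 0 < κ) (hκ' : 0 < κ') (x0 y0 y1 z0 : ℝ) (f : ℝ × ℝ × ℝ → ℝ) :
    (∫ p in {p : ℝ × ℝ × ℝ | y0 < p.2.1 ∧ p.2.1 ≤ y1 ∧ x0 ≤ p.1 ∧ p.1 < x0 + κ * (p.2.1 - y0) ∧
        z0 ≤ p.2.2 ∧ p.2.2 ≤ z0 + κ' * (p.2.1 - y0)}, f p =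
        ∫ p in Icc y0 y1 ×ˢ (Icc (0 : ℝ) 1 ×ˢ Icc (0 : ℝ) 1),
          κ * κ' * (p.1 - y0) ^ 2 * f (x0 + κ * (p.1 - y0) * p.2.1, p.1, z0 + κ' * (p.1 - y0) * p.2.2)) ∧
      (IntegrableOn f {p : ℝ × ℝ × ℝ | y0 < p.2.1 ∧ p.2.1 ≤ y1 ∧ x0 ≤ p.1 ∧ p.1 < x0 + κ * (p.2.1 - y0) ∧
          z0 ≤ p.2.2 ∧ p.2.2 ≤ z0 + κ' * (p.2.1 - y0)} volume ↔
        IntegrableOn (fun p : ℝ × ℝ × ℝ =>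
            κ * κ' * (p.1 - y0) ^ 2 * f (x0 + κ * (p.1 - y0) * p.2.1, p.1, z0 + κ' * (p.1 - y0) * p.2.2))
          (Icc y0 y1 ×ˢ (Icc (0 : ℝ) 1 ×ˢ Icc (0 : ℝ) 1)) volume) := by
  have hs : MeasurableSet (Ioc y0 y1 ×ˢ (Ico (0 : ℝ) 1 ×ˢ Icc (0 : ℝ) 1) : Set (ℝ × ℝ × ℝ)) :=
    measurableSet_Ioc.prod (measurableSet_Ico.prod measurableSet_Icc)
  have hf' : ∀ p ∈ (Ioc y0 y1 ×ˢ (Ico (0 : ℝ) 1 ×ˢ Icc (0 : ℝ) 1) : Set (ℝ × ℝ × ℝ)),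
      HasFDerivWithinAt (duffy3Y κ κ' x0 y0 z0) (fderivDuffy3Y κ κ' y0 p)
        (Ioc y0 y1 ×ˢ (Ico (0 : ℝ) 1 ×ˢ Icc (0 : ℝ) 1)) p :=
    fun p _ => (hasFDerivAt_duffy3Y κ κ' x0 y0 z0 p).hasFDerivWithinAt
  have hinj : InjOn (duffy3Y κ κ' x0 y0 z0) (Ioc y0 y1 ×ˢ (Ico (0 : ℝ) 1 ×ˢ Icc (0 : ℝ) 1)) :=
    (injOn_duffy3Y hκ hκ' x0 y0 z0 (Ico 0 1 ×ˢ Icc 0 1)).mono (prod_mono Ioc_subset_Ioi_self Subset.rfl)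
  have heqOn : EqOn (fun p : ℝ × ℝ × ℝ => |(fderivDuffy3Y κ κ' y0 p).det| • f (duffy3Y κ κ' x0 y0 z0 p))
      (fun p : ℝ × ℝ × ℝ =>
        κ * κ' * (p.1 - y0) ^ 2 * f (x0 + κ * (p.1 - y0) * p.2.1, p.1, z0 + κ' * (p.1 - y0) * p.2.2))
      (Ioc y0 y1 ×ˢ (Ico (0 : ℝ) 1 ×ˢ Icc (0 : ℝ) 1)) := by
    intro p _
    simp only [det_fderivDuffy3Y, smul_eq_mul, duffy3Y, abs_neg]
    rw [abs_of_nonneg (mul_nonneg (mul_nonneg hκ.le hκ'.le) (sq_nonneg _))]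
  rw [← image_duffy3Y hκ hκ' x0 y0 y1 z0]
  constructor
  · rw [integral_image_eq_integral_abs_det_fderiv_smul volume hs hf' hinj f, setIntegral_congr_fun hs heqOn,
      setIntegral_congr_set (Ioc_prod_Ico_prod_Icc_ae_eq y0 y1 0 1 0 1)]
  · rw [integrableOn_image_iff_integrableOn_abs_det_fderiv_smul volume hs hf' hinj f,
      integrableOn_congr_fun heqOn hs]
    exact ⟨fun h => h.congr_set_ae (Ioc_prod_Ico_prod_Icc_ae_eq y0 y1 0 1 0 1).symm,
      fun h => h.congr_set_ae (Ioc_prod_Ico_prod_Icc_ae_eq y0 y1 0 1 0 1)⟩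

/-- **Duffy's map onto the `z`-pyramid** (outer variable `z`): `(z, s, t) ↦ (x0 + κ (z − z0) s, y0 + κ' (z − z0) t, z)`.
[cite: Duffy1982, p. 1260] [cite: MousaviSukumar2009, Appendix A] -/
def duffy3Z (κ κ' x0 y0 z0 : ℝ) (p : ℝ × ℝ × ℝ) : ℝ × ℝ × ℝ :=
  (x0 + κ * (p.1 - z0) * p.2.1, y0 + κ' * (p.1 - z0) * p.2.2, p.1)

/-- The derivative of `duffy3Z` at `p = (z, s, t)`. [cite: MousaviSukumar2009, Appendix A] -/
noncomputable def fderivDuffy3Z (κ κ' z0 : ℝ) (p : ℝ × ℝ × ℝ) : (ℝ × ℝ × ℝ) →L[ℝ] ℝ × ℝ × ℝ :=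
  (((κ * p.2.1) • ContinuousLinearMap.fst ℝ ℝ (ℝ × ℝ) +
      (κ * (p.1 - z0)) • ((ContinuousLinearMap.fst ℝ ℝ ℝ).comp (ContinuousLinearMap.snd ℝ ℝ (ℝ × ℝ))))).prod
    (((κ' * p.2.2) • ContinuousLinearMap.fst ℝ ℝ (ℝ × ℝ) +
        (κ' * (p.1 - z0)) • ((ContinuousLinearMap.snd ℝ ℝ ℝ).comp (ContinuousLinearMap.snd ℝ ℝ (ℝ × ℝ)))).prod
      (ContinuousLinearMap.fst ℝ ℝ (ℝ × ℝ)))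

/-- The derivative as an explicit linear map of `ℝ × ℝ × ℝ`. [cite: MousaviSukumar2009, Appendix A] -/
@[simp] theorem fderivDuffy3Z_apply (κ κ' z0 : ℝ) (p v : ℝ × ℝ × ℝ) :
    fderivDuffy3Z κ κ' z0 p v =
      (κ * p.2.1 * v.1 + κ * (p.1 - z0) * v.2.1, κ' * p.2.2 * v.1 + κ' * (p.1 - z0) * v.2.2, v.1) := by
  simp [fderivDuffy3Z]

/-- [cite: MousaviSukumar2009, Appendix A] -/
theorem hasFDerivAt_duffy3Z (κ κ' x0 y0 z0 : ℝ) (p : ℝ × ℝ × ℝ) :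
    HasFDerivAt (duffy3Z κ κ' x0 y0 z0) (fderivDuffy3Z κ κ' z0 p) p := by
  have h1 : HasFDerivAt (fun q : ℝ × ℝ × ℝ => q.1) (ContinuousLinearMap.fst ℝ ℝ (ℝ × ℝ)) p := hasFDerivAt_fst
  have h2 : HasFDerivAt (fun q : ℝ × ℝ × ℝ => q.2.1)
      ((ContinuousLinearMap.fst ℝ ℝ ℝ).comp (ContinuousLinearMap.snd ℝ ℝ (ℝ × ℝ))) p := hasFDerivAt_snd.fst
  have h3 : HasFDerivAt (fun q : ℝ × ℝ × ℝ => q.2.2)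
      ((ContinuousLinearMap.snd ℝ ℝ ℝ).comp (ContinuousLinearMap.snd ℝ ℝ (ℝ × ℝ))) p := hasFDerivAt_snd.snd
  have h := ((((h1.sub_const z0).const_mul κ).mul h2).const_add x0).prodMk
    (((((h1.sub_const z0).const_mul κ').mul h3).const_add y0).prodMk h1)
  refine h.congr_fderiv (ContinuousLinearMap.ext fun v => ?_)
  rw [fderivDuffy3Z_apply]
  simp only [ContinuousLinearMap.prod_apply, FunLike.coe_add, FunLike.coe_smul, Pi.add_apply,
    Pi.smul_apply,
    ContinuousLinearMap.coe_fst', ContinuousLinearMap.coe_snd', ContinuousLinearMap.coe_comp,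
    Function.comp_apply, smul_eq_mul, Prod.mk.injEq]
  refine ⟨?_, ?_, trivial⟩ <;> ring

/-- The Jacobian determinant of the `z`-pyramid map: `κ κ' (z − z0)²`. [cite: MousaviSukumar2009, Appendix A] -/
theorem det_fderivDuffy3Z (κ κ' z0 : ℝ) (p : ℝ × ℝ × ℝ) :
    (fderivDuffy3Z κ κ' z0 p).det = κ * κ' * (p.1 - z0) ^ 2 := by
  rw [det_eq_det_toMatrix3, Matrix.det_fin_three]
  simp [LinearMap.toMatrix'_apply, coord3]
  ring

/-- The `z`-pyramid map is injective off the face `z = z0`. [cite: Duffy1982, p. 1260] -/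
theorem injOn_duffy3Z {κ κ' : ℝ} (hκ : 0 < κ) (hκ' : 0 < κ') (x0 y0 z0 : ℝ) (t : Set (ℝ × ℝ)) :
    InjOn (duffy3Z κ κ' x0 y0 z0) (Ioi z0 ×ˢ t) := by
  intro p hp q hq hpq
  rw [Set.mem_prod, Set.mem_Ioi] at hp
  simp only [duffy3Z, Prod.mk.injEq] at hpq
  obtain ⟨h2, h3, h1⟩ := hpq
  have hpos : 0 < κ * (p.1 - z0) := mul_pos hκ (sub_pos.2 hp.1)
  have hpos' : 0 < κ' * (p.1 - z0) := mul_pos hκ' (sub_pos.2 hp.1)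
  rw [← h1] at h2 h3
  have h4 : κ * (p.1 - z0) * p.2.1 = κ * (p.1 - z0) * q.2.1 := by linarith
  have h5 : κ' * (p.1 - z0) * p.2.2 = κ' * (p.1 - z0) * q.2.2 := by linarith
  exact Prod.ext h1 (Prod.ext (mul_left_cancel₀ hpos.ne' h4) (mul_left_cancel₀ hpos'.ne' h5))

/-- **The image of the `z`-pyramid map** on `(z0, z1] × [0, 1) × [0, 1)` is the pyramid
`{z0 < z ≤ z1, x0 ≤ x < x0 + κ (z − z0), y0 ≤ y < y0 + κ' (z − z0)}` (open towards the other two pyramids).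
[cite: Duffy1982, p. 1260] -/
theorem image_duffy3Z {κ κ' : ℝ} (hκ : 0 < κ) (hκ' : 0 < κ') (x0 y0 z0 z1 : ℝ) :
    duffy3Z κ κ' x0 y0 z0 '' (Ioc z0 z1 ×ˢ (Ico 0 1 ×ˢ Ico 0 1)) =
      {p : ℝ × ℝ × ℝ | z0 < p.2.2 ∧ p.2.2 ≤ z1 ∧ x0 ≤ p.1 ∧ p.1 < x0 + κ * (p.2.2 - z0) ∧
        y0 ≤ p.2.1 ∧ p.2.1 < y0 + κ' * (p.2.2 - z0)} := by
  ext p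
  simp only [Set.mem_image, Set.mem_prod, Set.mem_Ioc, Set.mem_Ico, Set.mem_setOf_eq]
  constructor
  · rintro ⟨q, ⟨⟨hq1, hq2⟩, ⟨hq3, hq4⟩, hq5, hq6⟩, rfl⟩
    have hpos : 0 < κ * (q.1 - z0) := mul_pos hκ (sub_pos.2 hq1)
    have hpos' : 0 < κ' * (q.1 - z0) := mul_pos hκ' (sub_pos.2 hq1)
    refine ⟨hq1, hq2, ?_, ?_, ?_, ?_⟩
    · show x0 ≤ x0 + κ * (q.1 - z0) * q.2.1
      nlinarith
    · show x0 + κ * (q.1 - z0) * q.2.1 < x0 + κ * (q.1 - z0)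
      nlinarith
    · show y0 ≤ y0 + κ' * (q.1 - z0) * q.2.2
      nlinarith
    · show y0 + κ' * (q.1 - z0) * q.2.2 < y0 + κ' * (q.1 - z0)
      nlinarith
  · rintro ⟨h1, h2, h3, h4, h5, h6⟩
    have hpos : 0 < κ * (p.2.2 - z0) := mul_pos hκ (sub_pos.2 h1)
    have hpos' : 0 < κ' * (p.2.2 - z0) := mul_pos hκ' (sub_pos.2 h1)
    refine ⟨(p.2.2, (p.1 - x0) / (κ * (p.2.2 - z0)), (p.2.1 - y0) / (κ' * (p.2.2 - z0))),
      ⟨⟨h1, h2⟩, ⟨div_nonneg (by linarith) hpos.le, ?_⟩, div_nonneg (by linarith) hpos'.le, ?_⟩, ?_⟩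
    · rw [div_lt_one hpos]; linarith
    · rw [div_lt_one hpos']; linarith
    · simp only [duffy3Z]
      rw [mul_div_cancel₀ _ hpos.ne', mul_div_cancel₀ _ hpos'.ne']
      ext <;> simp

/-- [folklore] -/
private theorem Ico_prod_Ico_ae_eq2 (c d e g : ℝ) :
    (Ico c d ×ˢ Ico e g : Set (ℝ × ℝ)) =ᵐ[volume] (Icc c d ×ˢ Icc e g : Set (ℝ × ℝ)) := by
  rw [Measure.volume_eq_prod]
  exact Measure.set_prod_ae_eq Ico_ae_eq_Icc Ico_ae_eq_Icc

/-- [folklore] -/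
private theorem Ioc_prod_Ico_prod_Ico_ae_eq (a b c d e g : ℝ) :
    (Ioc a b ×ˢ (Ico c d ×ˢ Ico e g) : Set (ℝ × ℝ × ℝ)) =ᵐ[volume] (Icc a b ×ˢ (Icc c d ×ˢ Icc e g) : Set (ℝ × ℝ × ℝ)) := by
  rw [Measure.volume_eq_prod]
  exact Measure.set_prod_ae_eq Ioc_ae_eq_Icc (Ico_prod_Ico_ae_eq2 c d e g)

/-- **Duffy's substitution on the `z`-pyramid** (no hypothesis on `f`), with the transfer of integrability.
[cite: Duffy1982, p. 1260] [cite: MousaviSukumar2009, Appendix A] -/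
theorem setIntegral_duffy3Z {κ κ' : ℝ} (hκ : 0 < κ) (hκ' : 0 < κ') (x0 y0 z0 z1 : ℝ) (f : ℝ × ℝ × ℝ → ℝ) :
    (∫ p in {p : ℝ × ℝ × ℝ | z0 < p.2.2 ∧ p.2.2 ≤ z1 ∧ x0 ≤ p.1 ∧ p.1 < x0 + κ * (p.2.2 - z0) ∧
        y0 ≤ p.2.1 ∧ p.2.1 < y0 + κ' * (p.2.2 - z0)}, f p =
        ∫ p in Icc z0 z1 ×ˢ (Icc (0 : ℝ) 1 ×ˢ Icc (0 : ℝ) 1),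
          κ * κ' * (p.1 - z0) ^ 2 * f (x0 + κ * (p.1 - z0) * p.2.1, y0 + κ' * (p.1 - z0) * p.2.2, p.1)) ∧
      (IntegrableOn f {p : ℝ × ℝ × ℝ | z0 < p.2.2 ∧ p.2.2 ≤ z1 ∧ x0 ≤ p.1 ∧ p.1 < x0 + κ * (p.2.2 - z0) ∧
          y0 ≤ p.2.1 ∧ p.2.1 < y0 + κ' * (p.2.2 - z0)} volume ↔
        IntegrableOn (fun p : ℝ × ℝ × ℝ =>
            κ * κ' * (p.1 - z0) ^ 2 * f (x0 + κ * (p.1 - z0) * p.2.1, y0 + κ' * (p.1 - z0) * p.2.2, p.1))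
          (Icc z0 z1 ×ˢ (Icc (0 : ℝ) 1 ×ˢ Icc (0 : ℝ) 1)) volume) := by
  have hs : MeasurableSet (Ioc z0 z1 ×ˢ (Ico (0 : ℝ) 1 ×ˢ Ico (0 : ℝ) 1) : Set (ℝ × ℝ × ℝ)) :=
    measurableSet_Ioc.prod (measurableSet_Ico.prod measurableSet_Ico)
  have hf' : ∀ p ∈ (Ioc z0 z1 ×ˢ (Ico (0 : ℝ) 1 ×ˢ Ico (0 : ℝ) 1) : Set (ℝ × ℝ × ℝ)),
      HasFDerivWithinAt (duffy3Z κ κ' x0 y0 z0) (fderivDuffy3Z κ κ' z0 p)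
        (Ioc z0 z1 ×ˢ (Ico (0 : ℝ) 1 ×ˢ Ico (0 : ℝ) 1)) p :=
    fun p _ => (hasFDerivAt_duffy3Z κ κ' x0 y0 z0 p).hasFDerivWithinAt
  have hinj : InjOn (duffy3Z κ κ' x0 y0 z0) (Ioc z0 z1 ×ˢ (Ico (0 : ℝ) 1 ×ˢ Ico (0 : ℝ) 1)) :=
    (injOn_duffy3Z hκ hκ' x0 y0 z0 (Ico 0 1 ×ˢ Ico 0 1)).mono (prod_mono Ioc_subset_Ioi_self Subset.rfl)
  have heqOn : EqOn (fun p : ℝ × ℝ × ℝ => |(fderivDuffy3Z κ κ' z0 p).det| • f (duffy3Z κ κ' x0 y0 z0 p))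
      (fun p : ℝ × ℝ × ℝ =>
        κ * κ' * (p.1 - z0) ^ 2 * f (x0 + κ * (p.1 - z0) * p.2.1, y0 + κ' * (p.1 - z0) * p.2.2, p.1))
      (Ioc z0 z1 ×ˢ (Ico (0 : ℝ) 1 ×ˢ Ico (0 : ℝ) 1)) := by
    intro p _
    simp only [det_fderivDuffy3Z, smul_eq_mul, duffy3Z]
    rw [abs_of_nonneg (mul_nonneg (mul_nonneg hκ.le hκ'.le) (sq_nonneg _))]
  rw [← image_duffy3Z hκ hκ' x0 y0 z0 z1]
  constructor
  · rw [integral_image_eq_integral_abs_det_fderiv_smul volume hs hf' hinj f, setIntegral_congr_fun hs heqOn,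
      setIntegral_congr_set (Ioc_prod_Ico_prod_Ico_ae_eq z0 z1 0 1 0 1)]
  · rw [integrableOn_image_iff_integrableOn_abs_det_fderiv_smul volume hs hf' hinj f,
      integrableOn_congr_fun heqOn hs]
    exact ⟨fun h => h.congr_set_ae (Ioc_prod_Ico_prod_Ico_ae_eq z0 z1 0 1 0 1).symm,
      fun h => h.congr_set_ae (Ioc_prod_Ico_prod_Ico_ae_eq z0 z1 0 1 0 1)⟩

/-- [folklore] -/
private theorem measurableSet_pyr3Y (x0 y0 y1 z0 κ κ' : ℝ) :
    MeasurableSet {p : ℝ × ℝ × ℝ | y0 < p.2.1 ∧ p.2.1 ≤ y1 ∧ x0 ≤ p.1 ∧ p.1 < x0 + κ * (p.2.1 - y0) ∧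
      z0 ≤ p.2.2 ∧ p.2.2 ≤ z0 + κ' * (p.2.1 - y0)} := by
  have m1 : Measurable fun p : ℝ × ℝ × ℝ => p.1 := measurable_fst
  have m2 : Measurable fun p : ℝ × ℝ × ℝ => p.2.1 := measurable_snd.fst
  have m3 : Measurable fun p : ℝ × ℝ × ℝ => p.2.2 := measurable_snd.snd
  have e : {p : ℝ × ℝ × ℝ | y0 < p.2.1 ∧ p.2.1 ≤ y1 ∧ x0 ≤ p.1 ∧ p.1 < x0 + κ * (p.2.1 - y0) ∧
      z0 ≤ p.2.2 ∧ p.2.2 ≤ z0 + κ' * (p.2.1 - y0)} = ({p : ℝ × ℝ × ℝ | y0 < p.2.1} ∩ {p : ℝ × ℝ × ℝ | p.2.1 ≤ y1}) ∩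
      (({p : ℝ × ℝ × ℝ | x0 ≤ p.1} ∩ {p : ℝ × ℝ × ℝ | p.1 < x0 + κ * (p.2.1 - y0)}) ∩
        ({p : ℝ × ℝ × ℝ | z0 ≤ p.2.2} ∩ {p : ℝ × ℝ × ℝ | p.2.2 ≤ z0 + κ' * (p.2.1 - y0)})) := by
    ext p
    simp only [Set.mem_setOf_eq, Set.mem_inter_iff]
    tauto
  rw [e]
  exact ((measurableSet_lt measurable_const m2).inter (measurableSet_le m2 measurable_const)).inter
    (((measurableSet_le measurable_const m1).inter (measurableSet_lt m1 (measurable_const.add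
      (measurable_const.mul (m2.sub measurable_const))))).inter
      ((measurableSet_le measurable_const m3).inter (measurableSet_le m3 (measurable_const.add
        (measurable_const.mul (m2.sub measurable_const))))))

/-- [folklore] -/
private theorem measurableSet_pyr3Z (x0 y0 z0 z1 κ κ' : ℝ) :
    MeasurableSet {p : ℝ × ℝ × ℝ | z0 < p.2.2 ∧ p.2.2 ≤ z1 ∧ x0 ≤ p.1 ∧ p.1 < x0 + κ * (p.2.2 - z0) ∧
      y0 ≤ p.2.1 ∧ p.2.1 < y0 + κ' * (p.2.2 - z0)} := by
  have m1 : Measurable fun p : ℝ × ℝ × ℝ => p.1 := measurable_fst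
  have m2 : Measurable fun p : ℝ × ℝ × ℝ => p.2.1 := measurable_snd.fst
  have m3 : Measurable fun p : ℝ × ℝ × ℝ => p.2.2 := measurable_snd.snd
  have e : {p : ℝ × ℝ × ℝ | z0 < p.2.2 ∧ p.2.2 ≤ z1 ∧ x0 ≤ p.1 ∧ p.1 < x0 + κ * (p.2.2 - z0) ∧
      y0 ≤ p.2.1 ∧ p.2.1 < y0 + κ' * (p.2.2 - z0)} = ({p : ℝ × ℝ × ℝ | z0 < p.2.2} ∩ {p : ℝ × ℝ × ℝ | p.2.2 ≤ z1}) ∩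
      (({p : ℝ × ℝ × ℝ | x0 ≤ p.1} ∩ {p : ℝ × ℝ × ℝ | p.1 < x0 + κ * (p.2.2 - z0)}) ∩
        ({p : ℝ × ℝ × ℝ | y0 ≤ p.2.1} ∩ {p : ℝ × ℝ × ℝ | p.2.1 < y0 + κ' * (p.2.2 - z0)})) := by
    ext p
    simp only [Set.mem_setOf_eq, Set.mem_inter_iff]
    tauto
  rw [e]
  exact ((measurableSet_lt measurable_const m3).inter (measurableSet_le m3 measurable_const)).inter
    (((measurableSet_le measurable_const m1).inter (measurableSet_lt m1 (measurable_const.add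
      (measurable_const.mul (m3.sub measurable_const))))).inter
      ((measurableSet_le measurable_const m2).inter (measurableSet_lt m2 (measurable_const.add
        (measurable_const.mul (m3.sub measurable_const))))))

/-- [folklore] the closed box minus the three pyramids is at most the singular vertex. -/
private theorem duffy3_cover {x0 x1 y0 y1 z0 z1 κ₁ κ₁' κ₂ κ₂' κ₃ κ₃' : ℝ} (hκ₁0 : 0 < κ₁) (hκ₁'0 : 0 < κ₁')
    (hκ₂0 : 0 < κ₂) (hκ₂'0 : 0 < κ₂') (hκ₃0 : 0 < κ₃) (hκ₃'0 : 0 < κ₃') (h21 : κ₂ * κ₁ = 1) (h31 : κ₃ * κ₁' = 1)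
    (h32 : κ₃' * κ₂' = 1) (h23 : κ₂ * κ₃' = κ₃) (h13 : κ₁ * κ₃ = κ₃') {p : ℝ × ℝ × ℝ}
    (hp : p ∈ Icc x0 x1 ×ˢ (Icc y0 y1 ×ˢ Icc z0 z1))
    (hnX : ¬ (x0 < p.1 ∧ p.1 ≤ x1 ∧ y0 ≤ p.2.1 ∧ p.2.1 ≤ y0 + κ₁ * (p.1 - x0) ∧
      z0 ≤ p.2.2 ∧ p.2.2 ≤ z0 + κ₁' * (p.1 - x0)))
    (hnY : ¬ (y0 < p.2.1 ∧ p.2.1 ≤ y1 ∧ x0 ≤ p.1 ∧ p.1 < x0 + κ₂ * (p.2.1 - y0) ∧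
      z0 ≤ p.2.2 ∧ p.2.2 ≤ z0 + κ₂' * (p.2.1 - y0)))
    (hnZ : ¬ (z0 < p.2.2 ∧ p.2.2 ≤ z1 ∧ x0 ≤ p.1 ∧ p.1 < x0 + κ₃ * (p.2.2 - z0) ∧
      y0 ≤ p.2.1 ∧ p.2.1 < y0 + κ₃' * (p.2.2 - z0))) : p = (x0, y0, z0) := by
  rw [Set.mem_prod, Set.mem_prod, Set.mem_Icc, Set.mem_Icc, Set.mem_Icc] at hp
  obtain ⟨⟨h1, h2⟩, ⟨h3, h4⟩, h5, h6⟩ := hp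
  have keyXY : κ₂ * (κ₁ * (p.1 - x0)) = p.1 - x0 := by rw [← mul_assoc, h21, one_mul]
  have keyXZ : κ₃ * (κ₁' * (p.1 - x0)) = p.1 - x0 := by rw [← mul_assoc, h31, one_mul]
  have keyYZ : κ₃' * (κ₂' * (p.2.1 - y0)) = p.2.1 - y0 := by rw [← mul_assoc, h32, one_mul]
  rcases le_or_gt p.2.1 (y0 + κ₁ * (p.1 - x0)) with hyle | hylt
  · rcases le_or_gt p.2.2 (z0 + κ₁' * (p.1 - x0)) with hzle | hzlt
    · -- inside the closed `x`-pyramid: not in `PX` forces `x = x0`, then `y = y0`, `z = z0`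
      have hx0 : p.1 = x0 := by
        by_contra hne
        exact hnX ⟨lt_of_le_of_ne h1 (Ne.symm hne), h2, h3, hyle, h5, hzle⟩
      have hy0 : p.2.1 = y0 := by
        rw [hx0, sub_self, mul_zero, add_zero] at hyle
        exact le_antisymm hyle h3
      have hz0 : p.2.2 = z0 := by
        rw [hx0, sub_self, mul_zero, add_zero] at hzle
        exact le_antisymm hzle h5
      exact Prod.ext hx0 (Prod.ext hy0 hz0)
    · -- `z` above the `x`-pyramid, `y` below: the point lies in `PZ`
      exfalso
      have hz0 : z0 < p.2.2 :=
        lt_of_le_of_lt (le_add_of_nonneg_right (mul_nonneg hκ₁'0.le (sub_nonneg.2 h1))) hzlt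
      have hxz : p.1 - x0 < κ₃ * (p.2.2 - z0) := by
        have h7 : κ₃ * (κ₁' * (p.1 - x0)) < κ₃ * (p.2.2 - z0) := mul_lt_mul_of_pos_left (by linarith) hκ₃0
        rw [keyXZ] at h7
        exact h7
      have hyz : p.2.1 - y0 < κ₃' * (p.2.2 - z0) := by
        have h7 : κ₁ * (p.1 - x0) < κ₁ * (κ₃ * (p.2.2 - z0)) := mul_lt_mul_of_pos_left hxz hκ₁0
        rw [← mul_assoc, h13] at h7
        linarith
      exact hnZ ⟨hz0, h6, h1, by linarith, h3, by linarith⟩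
  · -- `y` above the `x`-pyramid
    exfalso
    have hy0 : y0 < p.2.1 :=
      lt_of_le_of_lt (le_add_of_nonneg_right (mul_nonneg hκ₁0.le (sub_nonneg.2 h1))) hylt
    have hxy : p.1 - x0 < κ₂ * (p.2.1 - y0) := by
      have h7 : κ₂ * (κ₁ * (p.1 - x0)) < κ₂ * (p.2.1 - y0) := mul_lt_mul_of_pos_left (by linarith) hκ₂0
      rw [keyXY] at h7
      exact h7
    rcases le_or_gt p.2.2 (z0 + κ₂' * (p.2.1 - y0)) with hzle | hzlt
    · -- the point lies in `PY`
      exact hnY ⟨hy0, h4, h1, by linarith, h5, hzle⟩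
    · -- `z` above the `y`-pyramid as well: the point lies in `PZ`
      have hz0 : z0 < p.2.2 :=
        lt_of_le_of_lt (le_add_of_nonneg_right (mul_nonneg hκ₂'0.le (sub_nonneg.2 h3))) hzlt
      have hyz : p.2.1 - y0 < κ₃' * (p.2.2 - z0) := by
        have h7 : κ₃' * (κ₂' * (p.2.1 - y0)) < κ₃' * (p.2.2 - z0) := mul_lt_mul_of_pos_left (by linarith) hκ₃'0
        rw [keyYZ] at h7
        exact h7
      have hxz : p.1 - x0 < κ₃ * (p.2.2 - z0) := by
        have h7 : κ₂ * (p.2.1 - y0) < κ₂ * (κ₃' * (p.2.2 - z0)) := mul_lt_mul_of_pos_left hyz hκ₂0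
        rw [← mul_assoc, h23] at h7
        linarith
      exact hnZ ⟨hz0, h6, h1, by linarith, h3, by linarith⟩

/-- **Duffy's decomposition of a box into the three pyramids with apex at the singular vertex** `(x0, y0, z0)`
(op. cit. Sect. 1: "a cube … can be divided into three pyramids, each having the singularity at a vertex, and the
transformation applied to each"): with the slopes `κ₁ (x1 − x0) = y1 − y0`, `κ₁' (x1 − x0) = z1 − z0`,
`κ₂ (y1 − y0) = x1 − x0`, `κ₂' (y1 − y0) = z1 − z0`, `κ₃ (z1 − z0) = x1 − x0`, `κ₃' (z1 − z0) = y1 − y0`, if the three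
transformed integrands are integrable on their closed parameter boxes then `f` is integrable on the closed box and
`∫_R f` is the sum of the three transformed integrals. [cite: Duffy1982, p. 1260] [cite: MousaviSukumar2009, Sect. 1] -/
theorem duffy3_split {x0 x1 y0 y1 z0 z1 κ₁ κ₁' κ₂ κ₂' κ₃ κ₃' : ℝ} (hx : x0 < x1) (hy : y0 < y1) (hz : z0 < z1)
    (hκ₁ : κ₁ * (x1 - x0) = y1 - y0) (hκ₁' : κ₁' * (x1 - x0) = z1 - z0)
    (hκ₂ : κ₂ * (y1 - y0) = x1 - x0) (hκ₂' : κ₂' * (y1 - y0) = z1 - z0)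
    (hκ₃ : κ₃ * (z1 - z0) = x1 - x0) (hκ₃' : κ₃' * (z1 - z0) = y1 - y0) {f : ℝ × ℝ × ℝ → ℝ}
    (h₁ : IntegrableOn (fun p : ℝ × ℝ × ℝ =>
        κ₁ * κ₁' * (p.1 - x0) ^ 2 * f (p.1, y0 + κ₁ * (p.1 - x0) * p.2.1, z0 + κ₁' * (p.1 - x0) * p.2.2))
      (Icc x0 x1 ×ˢ (Icc (0 : ℝ) 1 ×ˢ Icc (0 : ℝ) 1)) volume)
    (h₂ : IntegrableOn (fun p : ℝ × ℝ × ℝ =>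
        κ₂ * κ₂' * (p.1 - y0) ^ 2 * f (x0 + κ₂ * (p.1 - y0) * p.2.1, p.1, z0 + κ₂' * (p.1 - y0) * p.2.2))
      (Icc y0 y1 ×ˢ (Icc (0 : ℝ) 1 ×ˢ Icc (0 : ℝ) 1)) volume)
    (h₃ : IntegrableOn (fun p : ℝ × ℝ × ℝ =>
        κ₃ * κ₃' * (p.1 - z0) ^ 2 * f (x0 + κ₃ * (p.1 - z0) * p.2.1, y0 + κ₃' * (p.1 - z0) * p.2.2, p.1))
      (Icc z0 z1 ×ˢ (Icc (0 : ℝ) 1 ×ˢ Icc (0 : ℝ) 1)) volume) :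
    IntegrableOn f (Icc x0 x1 ×ˢ (Icc y0 y1 ×ˢ Icc z0 z1)) volume ∧
      ∫ p in Icc x0 x1 ×ˢ (Icc y0 y1 ×ˢ Icc z0 z1), f p =
        (∫ p in Icc x0 x1 ×ˢ (Icc (0 : ℝ) 1 ×ˢ Icc (0 : ℝ) 1),
            κ₁ * κ₁' * (p.1 - x0) ^ 2 * f (p.1, y0 + κ₁ * (p.1 - x0) * p.2.1, z0 + κ₁' * (p.1 - x0) * p.2.2)) +
          (∫ p in Icc y0 y1 ×ˢ (Icc (0 : ℝ) 1 ×ˢ Icc (0 : ℝ) 1),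
            κ₂ * κ₂' * (p.1 - y0) ^ 2 * f (x0 + κ₂ * (p.1 - y0) * p.2.1, p.1, z0 + κ₂' * (p.1 - y0) * p.2.2)) +
          ∫ p in Icc z0 z1 ×ˢ (Icc (0 : ℝ) 1 ×ˢ Icc (0 : ℝ) 1),
            κ₃ * κ₃' * (p.1 - z0) ^ 2 * f (x0 + κ₃ * (p.1 - z0) * p.2.1, y0 + κ₃' * (p.1 - z0) * p.2.2, p.1) := by
  have hX : 0 < x1 - x0 := sub_pos.2 hx
  have hY : 0 < y1 - y0 := sub_pos.2 hy
  have hZ : 0 < z1 - z0 := sub_pos.2 hz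
  have hκ₁0 : 0 < κ₁ := by
    have h' : 0 < κ₁ * (x1 - x0) := by rw [hκ₁]; exact hY
    exact pos_of_mul_pos_left h' hX.le
  have hκ₁'0 : 0 < κ₁' := by
    have h' : 0 < κ₁' * (x1 - x0) := by rw [hκ₁']; exact hZ
    exact pos_of_mul_pos_left h' hX.le
  have hκ₂0 : 0 < κ₂ := by
    have h' : 0 < κ₂ * (y1 - y0) := by rw [hκ₂]; exact hX
    exact pos_of_mul_pos_left h' hY.le
  have hκ₂'0 : 0 < κ₂' := by
    have h' : 0 < κ₂' * (y1 - y0) := by rw [hκ₂']; exact hZ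
    exact pos_of_mul_pos_left h' hY.le
  have hκ₃0 : 0 < κ₃ := by
    have h' : 0 < κ₃ * (z1 - z0) := by rw [hκ₃]; exact hX
    exact pos_of_mul_pos_left h' hZ.le
  have hκ₃'0 : 0 < κ₃' := by
    have h' : 0 < κ₃' * (z1 - z0) := by rw [hκ₃']; exact hY
    exact pos_of_mul_pos_left h' hZ.le
  -- products of slopes
  have h21 : κ₂ * κ₁ = 1 := by
    have h3 : κ₂ * κ₁ * (x1 - x0) = 1 * (x1 - x0) := by rw [mul_assoc, hκ₁, hκ₂, one_mul]
    exact mul_right_cancel₀ hX.ne' h3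
  have h31 : κ₃ * κ₁' = 1 := by
    have h3 : κ₃ * κ₁' * (x1 - x0) = 1 * (x1 - x0) := by rw [mul_assoc, hκ₁', hκ₃, one_mul]
    exact mul_right_cancel₀ hX.ne' h3
  have h32 : κ₃' * κ₂' = 1 := by
    have h3 : κ₃' * κ₂' * (y1 - y0) = 1 * (y1 - y0) := by rw [mul_assoc, hκ₂', hκ₃', one_mul]
    exact mul_right_cancel₀ hY.ne' h3
  have h23 : κ₂ * κ₃' = κ₃ := by
    have h3 : κ₂ * κ₃' * (z1 - z0) = κ₃ * (z1 - z0) := by rw [mul_assoc, hκ₃', hκ₂, hκ₃]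
    exact mul_right_cancel₀ hZ.ne' h3
  have h13 : κ₁ * κ₃ = κ₃' := by
    have h3 : κ₁ * κ₃ * (z1 - z0) = κ₃' * (z1 - z0) := by rw [mul_assoc, hκ₃, hκ₁, hκ₃']
    exact mul_right_cancel₀ hZ.ne' h3
  set PX : Set (ℝ × ℝ × ℝ) := {p : ℝ × ℝ × ℝ | x0 < p.1 ∧ p.1 ≤ x1 ∧ y0 ≤ p.2.1 ∧ p.2.1 ≤ y0 + κ₁ * (p.1 - x0) ∧
    z0 ≤ p.2.2 ∧ p.2.2 ≤ z0 + κ₁' * (p.1 - x0)} with hPX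
  set PY : Set (ℝ × ℝ × ℝ) := {p : ℝ × ℝ × ℝ | y0 < p.2.1 ∧ p.2.1 ≤ y1 ∧ x0 ≤ p.1 ∧ p.1 < x0 + κ₂ * (p.2.1 - y0) ∧
    z0 ≤ p.2.2 ∧ p.2.2 ≤ z0 + κ₂' * (p.2.1 - y0)} with hPY
  set PZ : Set (ℝ × ℝ × ℝ) := {p : ℝ × ℝ × ℝ | z0 < p.2.2 ∧ p.2.2 ≤ z1 ∧ x0 ≤ p.1 ∧ p.1 < x0 + κ₃ * (p.2.2 - z0) ∧
    y0 ≤ p.2.1 ∧ p.2.1 < y0 + κ₃' * (p.2.2 - z0)} with hPZ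
  obtain ⟨eX, iX⟩ := setIntegral_duffy3X hκ₁0 hκ₁'0 x0 x1 y0 z0 f
  obtain ⟨eY, iY⟩ := setIntegral_duffy3Y hκ₂0 hκ₂'0 x0 y0 y1 z0 f
  obtain ⟨eZ, iZ⟩ := setIntegral_duffy3Z hκ₃0 hκ₃'0 x0 y0 z0 z1 f
  rw [← hPX] at eX iX
  rw [← hPY] at eY iY
  rw [← hPZ] at eZ iZ
  have hfX : IntegrableOn f PX volume := iX.2 h₁
  have hfY : IntegrableOn f PY volume := iY.2 h₂
  have hfZ : IntegrableOn f PZ volume := iZ.2 h₃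
  -- measurability of the pyramids
  have hPYm : MeasurableSet PY := measurableSet_pyr3Y x0 y0 y1 z0 κ₂ κ₂'
  have hPZm : MeasurableSet PZ := measurableSet_pyr3Z x0 y0 z0 z1 κ₃ κ₃'
  -- the three pyramids are pairwise disjoint and tile the box up to the vertex
  have hdXY : Disjoint PX PY := by
    refine Set.disjoint_left.2 fun p hX' hY' => ?_
    rw [hPX, Set.mem_setOf_eq] at hX'
    rw [hPY, Set.mem_setOf_eq] at hY'
    have key : κ₂ * (κ₁ * (p.1 - x0)) = p.1 - x0 := by rw [← mul_assoc, h21, one_mul]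
    have h4 : κ₂ * (p.2.1 - y0) ≤ κ₂ * (κ₁ * (p.1 - x0)) :=
      mul_le_mul_of_nonneg_left (by linarith [hX'.2.2.2.1]) hκ₂0.le
    rw [key] at h4
    linarith [hY'.2.2.2.1]
  have hdXZ : Disjoint PX PZ := by
    refine Set.disjoint_left.2 fun p hX' hZ' => ?_
    rw [hPX, Set.mem_setOf_eq] at hX'
    rw [hPZ, Set.mem_setOf_eq] at hZ'
    have key : κ₃ * (κ₁' * (p.1 - x0)) = p.1 - x0 := by rw [← mul_assoc, h31, one_mul]
    have h4 : κ₃ * (p.2.2 - z0) ≤ κ₃ * (κ₁' * (p.1 - x0)) :=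
      mul_le_mul_of_nonneg_left (by linarith [hX'.2.2.2.2.2]) hκ₃0.le
    rw [key] at h4
    linarith [hZ'.2.2.2.1]
  have hdYZ : Disjoint PY PZ := by
    refine Set.disjoint_left.2 fun p hY' hZ' => ?_
    rw [hPY, Set.mem_setOf_eq] at hY'
    rw [hPZ, Set.mem_setOf_eq] at hZ'
    have key : κ₃' * (κ₂' * (p.2.1 - y0)) = p.2.1 - y0 := by rw [← mul_assoc, h32, one_mul]
    have h4 : κ₃' * (p.2.2 - z0) ≤ κ₃' * (κ₂' * (p.2.1 - y0)) :=
      mul_le_mul_of_nonneg_left (by linarith [hY'.2.2.2.2.2]) hκ₃'0.le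
    rw [key] at h4
    linarith [hZ'.2.2.2.2.2]
  have hdX_YZ : Disjoint PX (PY ∪ PZ) := Set.disjoint_union_right.2 ⟨hdXY, hdXZ⟩
  have hsub : PX ∪ (PY ∪ PZ) ⊆ Icc x0 x1 ×ˢ (Icc y0 y1 ×ˢ Icc z0 z1) := by
    rintro p (hX' | hY' | hZ')
    · rw [hPX, Set.mem_setOf_eq] at hX'
      obtain ⟨h1, h2, h3, h4, h5, h6⟩ := hX'
      have h7 : κ₁ * (p.1 - x0) ≤ κ₁ * (x1 - x0) := mul_le_mul_of_nonneg_left (by linarith) hκ₁0.le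
      have h8 : κ₁' * (p.1 - x0) ≤ κ₁' * (x1 - x0) := mul_le_mul_of_nonneg_left (by linarith) hκ₁'0.le
      rw [hκ₁] at h7
      rw [hκ₁'] at h8
      exact ⟨⟨h1.le, h2⟩, ⟨h3, by linarith⟩, h5, by linarith⟩
    · rw [hPY, Set.mem_setOf_eq] at hY'
      obtain ⟨h1, h2, h3, h4, h5, h6⟩ := hY'
      have h7 : κ₂ * (p.2.1 - y0) ≤ κ₂ * (y1 - y0) := mul_le_mul_of_nonneg_left (by linarith) hκ₂0.le
      have h8 : κ₂' * (p.2.1 - y0) ≤ κ₂' * (y1 - y0) := mul_le_mul_of_nonneg_left (by linarith) hκ₂'0.le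
      rw [hκ₂] at h7
      rw [hκ₂'] at h8
      exact ⟨⟨h3, by linarith⟩, ⟨h1.le, h2⟩, h5, by linarith⟩
    · rw [hPZ, Set.mem_setOf_eq] at hZ'
      obtain ⟨h1, h2, h3, h4, h5, h6⟩ := hZ'
      have h7 : κ₃ * (p.2.2 - z0) ≤ κ₃ * (z1 - z0) := mul_le_mul_of_nonneg_left (by linarith) hκ₃0.le
      have h8 : κ₃' * (p.2.2 - z0) ≤ κ₃' * (z1 - z0) := mul_le_mul_of_nonneg_left (by linarith) hκ₃'0.le
      rw [hκ₃] at h7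
      rw [hκ₃'] at h8
      exact ⟨⟨h3, by linarith⟩, ⟨h5, by linarith⟩, h1.le, h2⟩
  have hcov : Icc x0 x1 ×ˢ (Icc y0 y1 ×ˢ Icc z0 z1) \ (PX ∪ (PY ∪ PZ)) ⊆ {(x0, y0, z0)} := by
    rintro p ⟨hp, hn⟩
    rw [Set.mem_union, Set.mem_union, not_or, not_or, hPX, hPY, hPZ, Set.mem_setOf_eq, Set.mem_setOf_eq,
      Set.mem_setOf_eq] at hn
    exact Set.mem_singleton_iff.2 (duffy3_cover hκ₁0 hκ₁'0 hκ₂0 hκ₂'0 hκ₃0 hκ₃'0 h21 h31 h32 h23 h13 hp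
      hn.1 hn.2.1 hn.2.2)
  have hae : (PX ∪ (PY ∪ PZ) : Set (ℝ × ℝ × ℝ)) =ᵐ[volume] (Icc x0 x1 ×ˢ (Icc y0 y1 ×ˢ Icc z0 z1) : Set (ℝ × ℝ × ℝ)) := by
    refine ae_eq_set.2 ⟨?_, ?_⟩
    · exact measure_mono_null (fun p hp => (hp.2 (hsub hp.1)).elim) measure_empty
    · exact measure_mono_null hcov (measure_singleton _)
  have hfYZ : IntegrableOn f (PY ∪ PZ) volume := hfY.union hfZ
  have hfall : IntegrableOn f (PX ∪ (PY ∪ PZ)) volume := hfX.union hfYZ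
  refine ⟨hfall.congr_set_ae hae.symm, ?_⟩
  rw [← setIntegral_congr_set hae, setIntegral_union hdX_YZ (hPYm.union hPZm) hfX hfYZ,
    setIntegral_union hdYZ hPZm hfY hfZ, eX, eY, eZ, add_assoc]

/-! ### Part C. Transfer to the face-weighted 3-D certificate -/

/-- [folklore] -/
private theorem Icc3_ae_eq_Ioo3 (a b c d e k : ℝ) :
    (Icc a b ×ˢ (Icc c d ×ˢ Icc e k) : Set (ℝ × ℝ × ℝ)) =ᵐ[volume]
      (Ioo a b ×ˢ (Ioo c d ×ˢ Ioo e k) : Set (ℝ × ℝ × ℝ)) := by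
  rw [Measure.volume_eq_prod]
  refine Measure.set_prod_ae_eq Ioo_ae_eq_Icc.symm ?_
  rw [Measure.volume_eq_prod]
  exact Measure.set_prod_ae_eq Ioo_ae_eq_Icc.symm Ioo_ae_eq_Icc.symm

/-- [folklore] -/
private theorem transfer_open_box3 {g w : ℝ × ℝ × ℝ → ℝ} {a b c d e k : ℝ}
    (heq : ∀ p : ℝ × ℝ × ℝ, a < p.1 → p.1 < b → c < p.2.1 → p.2.1 < d → e < p.2.2 → p.2.2 < k → g p = w p)
    (hw : IntegrableOn w (Icc a b ×ˢ (Icc c d ×ˢ Icc e k)) volume) :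
    IntegrableOn g (Icc a b ×ˢ (Icc c d ×ˢ Icc e k)) volume ∧
      ∫ p in Icc a b ×ˢ (Icc c d ×ˢ Icc e k), g p = ∫ p in Icc a b ×ˢ (Icc c d ×ˢ Icc e k), w p := by
  have hae := Icc3_ae_eq_Ioo3 a b c d e k
  have heqOn : EqOn g w (Ioo a b ×ˢ (Ioo c d ×ˢ Ioo e k)) := by
    intro p hp
    rw [Set.mem_prod, Set.mem_prod, Set.mem_Ioo, Set.mem_Ioo, Set.mem_Ioo] at hp
    exact heq p hp.1.1 hp.1.2 hp.2.1.1 hp.2.1.2 hp.2.2.1 hp.2.2.2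
  have hm : MeasurableSet (Ioo a b ×ˢ (Ioo c d ×ˢ Ioo e k) : Set (ℝ × ℝ × ℝ)) :=
    measurableSet_Ioo.prod (measurableSet_Ioo.prod measurableSet_Ioo)
  refine ⟨((integrableOn_congr_fun heqOn hm).2 (hw.congr_set_ae hae.symm)).congr_set_ae hae, ?_⟩
  rw [setIntegral_congr_set hae, setIntegral_congr_set hae, setIntegral_congr_fun hm heqOn]

/-- **Kernel-checked bounds for a triple integral with an algebraic singularity at the vertex `(x0, y0, z0)`** of
the rational box `R = [x0, x1] × [y0, y1] × [z0, z1]` (Duffy's transformation on the three pyramids composed with the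
face-weighted 3-D kd-tree certificate; the six slopes `κ₁ = (y1 − y0)/(x1 − x0)`, `κ₁' = (z1 − z0)/(x1 − x0)`,
`κ₂ = (x1 − x0)/(y1 − y0)`, `κ₂' = (z1 − z0)/(y1 − y0)`, `κ₃ = (x1 − x0)/(z1 − z0)`, `κ₃' = (y1 − y0)/(z1 − z0)` given as
rationals).  HYPOTHESES ON `f`: only the three pointwise identities on the OPEN parameter boxes
`(x0, x1) × (0, 1)²`, `(y0, y1) × (0, 1)²`, `(z0, z1) × (0, 1)²` exhibiting the transformed integrands
`κ₁ κ₁' (x − x0)² f(x, y0 + κ₁ (x − x0) s, z0 + κ₁' (x − x0) t)` (etc.) as face-weighted code-list integrands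
`wfunL3 ωᵢ ⟨·, ·, 0, 1, 0, 1⟩ Fᵢ` (a vertex singularity `r^{−σ}`, `σ < 3`, becomes the face weight `(x − x0)^{2−σ}` times a
code list regular on the closed parameter box — op. cit.: "the Jacobian `u²` exactly cancels the `1/r²`-type
singularity"), plus the `decide`-able obligations of the three certificates.  CONCLUSION: `f` is integrable on the
closed box and `lo₁ + lo₂ + lo₃ ≤ ∫_{x0}^{x1} ∫_{y0}^{y1} ∫_{z0}^{z1} f ≤ hi₁ + hi₂ + hi₃`.
[cite: Duffy1982, p. 1260] [cite: MousaviSukumar2009, Sect. 1] [cite: DavisRabinowitz1984, Sect. 5.6]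
[cite: DavisRabinowitz1984, Sect. 2.12.5] [cite: MakinoBerz2003, Algorithm 2]
[cite: MahboubiMelquiondSibutpinote2016, Sect. 3.3] -/
theorem integral_bounds_of_duffy3CheckWL3 {S : ℕ} {R : Box3Q} {κ₁ κ₁' κ₂ κ₂' κ₃ κ₃' : ℚ} (hx : R.x0 < R.x1)
    (hy : R.y0 < R.y1) (hz : R.z0 < R.z1)
    (hκ₁ : κ₁ * (R.x1 - R.x0) = R.y1 - R.y0) (hκ₁' : κ₁' * (R.x1 - R.x0) = R.z1 - R.z0)
    (hκ₂ : κ₂ * (R.y1 - R.y0) = R.x1 - R.x0) (hκ₂' : κ₂' * (R.y1 - R.y0) = R.z1 - R.z0)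
    (hκ₃ : κ₃ * (R.z1 - R.z0) = R.x1 - R.x0) (hκ₃' : κ₃' * (R.z1 - R.z0) = R.y1 - R.y0)
    {f : ℝ → ℝ → ℝ → ℝ} {F₁ F₂ F₃ : BExpr3T} {ω₁ ω₂ ω₃ : WLPrm3} {t₁ t₂ t₃ : KdTree3} {n₁ n₂ n₃ : ℕ}
    {lo₁ hi₁ lo₂ hi₂ lo₃ hi₃ : ℚ}
    (hf₁ : ∀ x s t : ℝ, (R.x0 : ℝ) < x → x < R.x1 → 0 < s → s < 1 → 0 < t → t < 1 →
      (κ₁ : ℝ) * κ₁' * (x - R.x0) ^ 2 * f x (R.y0 + κ₁ * (x - R.x0) * s) (R.z0 + κ₁' * (x - R.x0) * t) =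
        wfunL3 ω₁ ⟨R.x0, R.x1, 0, 1, 0, 1⟩ F₁ x s t)
    (hf₂ : ∀ y s t : ℝ, (R.y0 : ℝ) < y → y < R.y1 → 0 < s → s < 1 → 0 < t → t < 1 →
      (κ₂ : ℝ) * κ₂' * (y - R.y0) ^ 2 * f (R.x0 + κ₂ * (y - R.y0) * s) y (R.z0 + κ₂' * (y - R.y0) * t) =
        wfunL3 ω₂ ⟨R.y0, R.y1, 0, 1, 0, 1⟩ F₂ y s t)
    (hf₃ : ∀ z s t : ℝ, (R.z0 : ℝ) < z → z < R.z1 → 0 < s → s < 1 → 0 < t → t < 1 →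
      (κ₃ : ℝ) * κ₃' * (z - R.z0) ^ 2 * f (R.x0 + κ₃ * (z - R.z0) * s) (R.y0 + κ₃' * (z - R.z0) * t) z =
        wfunL3 ω₃ ⟨R.z0, R.z1, 0, 1, 0, 1⟩ F₃ z s t)
    (hleaf₁ : ∀ i : ℕ, i < n₁ → leafCheckWL3 S F₁ ω₁ ⟨R.x0, R.x1, 0, 1, 0, 1⟩ t₁ i = true)
    (ht₁ : treeCheckWL3 S t₁ n₁ lo₁ hi₁ = true)
    (hleaf₂ : ∀ i : ℕ, i < n₂ → leafCheckWL3 S F₂ ω₂ ⟨R.y0, R.y1, 0, 1, 0, 1⟩ t₂ i = true)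
    (ht₂ : treeCheckWL3 S t₂ n₂ lo₂ hi₂ = true)
    (hleaf₃ : ∀ i : ℕ, i < n₃ → leafCheckWL3 S F₃ ω₃ ⟨R.z0, R.z1, 0, 1, 0, 1⟩ t₃ i = true)
    (ht₃ : treeCheckWL3 S t₃ n₃ lo₃ hi₃ = true) :
    IntegrableOn (fun p : ℝ × ℝ × ℝ => f p.1 p.2.1 p.2.2)
        (Icc (R.x0 : ℝ) R.x1 ×ˢ (Icc (R.y0 : ℝ) R.y1 ×ˢ Icc (R.z0 : ℝ) R.z1)) volume ∧
      ((lo₁ + lo₂ + lo₃ : ℚ) : ℝ) ≤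
          ∫ x in (R.x0 : ℝ)..R.x1, ∫ y in (R.y0 : ℝ)..R.y1, ∫ z in (R.z0 : ℝ)..R.z1, f x y z ∧
        ∫ x in (R.x0 : ℝ)..R.x1, ∫ y in (R.y0 : ℝ)..R.y1, ∫ z in (R.z0 : ℝ)..R.z1, f x y z ≤
          ((hi₁ + hi₂ + hi₃ : ℚ) : ℝ) := by
  -- the three face-weighted certificates: enclosures and joint integrability, then Fubini
  obtain ⟨hlo₁, hhi₁⟩ := integral_bounds_of_leafCheck3R (f := wfunL3 ω₁ ⟨R.x0, R.x1, 0, 1, 0, 1⟩ F₁)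
    (Λ := leafEnclWL3 S F₁ ω₁ ⟨R.x0, R.x1, 0, 1, 0, 1⟩)
    (fun hS B P hok => leafEnclWL3_sound hS F₁ ω₁ _ B P hok) hleaf₁ ht₁
  obtain ⟨hlo₂, hhi₂⟩ := integral_bounds_of_leafCheck3R (f := wfunL3 ω₂ ⟨R.y0, R.y1, 0, 1, 0, 1⟩ F₂)
    (Λ := leafEnclWL3 S F₂ ω₂ ⟨R.y0, R.y1, 0, 1, 0, 1⟩)
    (fun hS B P hok => leafEnclWL3_sound hS F₂ ω₂ _ B P hok) hleaf₂ ht₂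
  obtain ⟨hlo₃, hhi₃⟩ := integral_bounds_of_leafCheck3R (f := wfunL3 ω₃ ⟨R.z0, R.z1, 0, 1, 0, 1⟩ F₃)
    (Λ := leafEnclWL3 S F₃ ω₃ ⟨R.z0, R.z1, 0, 1, 0, 1⟩)
    (fun hS B P hok => leafEnclWL3_sound hS F₃ ω₃ _ B P hok) hleaf₃ ht₃
  obtain ⟨hI₁, -, -, -⟩ := integrableOn_wfunL3_of_leafCheckWL3 hleaf₁ ht₁
  obtain ⟨hI₂, -, -, -⟩ := integrableOn_wfunL3_of_leafCheckWL3 hleaf₂ ht₂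
  obtain ⟨hI₃, -, -, -⟩ := integrableOn_wfunL3_of_leafCheckWL3 hleaf₃ ht₃
  simp only [Rat.cast_zero, Rat.cast_one] at hlo₁ hhi₁ hlo₂ hhi₂ hlo₃ hhi₃ hI₁ hI₂ hI₃
  have hxr : (R.x0 : ℝ) < R.x1 := by exact_mod_cast hx
  have hyr : (R.y0 : ℝ) < R.y1 := by exact_mod_cast hy
  have hzr : (R.z0 : ℝ) < R.z1 := by exact_mod_cast hz
  rw [intervalIntegral_iterated3_eq_setIntegral_prod hxr.le zero_le_one zero_le_one hI₁] at hlo₁ hhi₁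
  rw [intervalIntegral_iterated3_eq_setIntegral_prod hyr.le zero_le_one zero_le_one hI₂] at hlo₂ hhi₂
  rw [intervalIntegral_iterated3_eq_setIntegral_prod hzr.le zero_le_one zero_le_one hI₃] at hlo₃ hhi₃
  -- the transformed integrands agree with the weighted integrands on the open parameter boxes
  obtain ⟨hg₁, eg₁⟩ := transfer_open_box3
    (g := fun p : ℝ × ℝ × ℝ =>
      (κ₁ : ℝ) * κ₁' * (p.1 - R.x0) ^ 2 * f p.1 (R.y0 + κ₁ * (p.1 - R.x0) * p.2.1) (R.z0 + κ₁' * (p.1 - R.x0) * p.2.2))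
    (w := fun p : ℝ × ℝ × ℝ => wfunL3 ω₁ ⟨R.x0, R.x1, 0, 1, 0, 1⟩ F₁ p.1 p.2.1 p.2.2)
    (fun p h1 h2 h3 h4 h5 h6 => hf₁ p.1 p.2.1 p.2.2 h1 h2 h3 h4 h5 h6) hI₁
  obtain ⟨hg₂, eg₂⟩ := transfer_open_box3
    (g := fun p : ℝ × ℝ × ℝ =>
      (κ₂ : ℝ) * κ₂' * (p.1 - R.y0) ^ 2 * f (R.x0 + κ₂ * (p.1 - R.y0) * p.2.1) p.1 (R.z0 + κ₂' * (p.1 - R.y0) * p.2.2))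
    (w := fun p : ℝ × ℝ × ℝ => wfunL3 ω₂ ⟨R.y0, R.y1, 0, 1, 0, 1⟩ F₂ p.1 p.2.1 p.2.2)
    (fun p h1 h2 h3 h4 h5 h6 => hf₂ p.1 p.2.1 p.2.2 h1 h2 h3 h4 h5 h6) hI₂
  obtain ⟨hg₃, eg₃⟩ := transfer_open_box3
    (g := fun p : ℝ × ℝ × ℝ =>
      (κ₃ : ℝ) * κ₃' * (p.1 - R.z0) ^ 2 * f (R.x0 + κ₃ * (p.1 - R.z0) * p.2.1) (R.y0 + κ₃' * (p.1 - R.z0) * p.2.2) p.1)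
    (w := fun p : ℝ × ℝ × ℝ => wfunL3 ω₃ ⟨R.z0, R.z1, 0, 1, 0, 1⟩ F₃ p.1 p.2.1 p.2.2)
    (fun p h1 h2 h3 h4 h5 h6 => hf₃ p.1 p.2.1 p.2.2 h1 h2 h3 h4 h5 h6) hI₃
  -- Duffy's decomposition into the three pyramids
  have hκ₁r : (κ₁ : ℝ) * (R.x1 - R.x0) = R.y1 - R.y0 := by exact_mod_cast hκ₁
  have hκ₁'r : (κ₁' : ℝ) * (R.x1 - R.x0) = R.z1 - R.z0 := by exact_mod_cast hκ₁'
  have hκ₂r : (κ₂ : ℝ) * (R.y1 - R.y0) = R.x1 - R.x0 := by exact_mod_cast hκ₂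
  have hκ₂'r : (κ₂' : ℝ) * (R.y1 - R.y0) = R.z1 - R.z0 := by exact_mod_cast hκ₂'
  have hκ₃r : (κ₃ : ℝ) * (R.z1 - R.z0) = R.x1 - R.x0 := by exact_mod_cast hκ₃
  have hκ₃'r : (κ₃' : ℝ) * (R.z1 - R.z0) = R.y1 - R.y0 := by exact_mod_cast hκ₃'
  obtain ⟨hIf, ef⟩ := duffy3_split (f := fun p : ℝ × ℝ × ℝ => f p.1 p.2.1 p.2.2) hxr hyr hzr
    hκ₁r hκ₁'r hκ₂r hκ₂'r hκ₃r hκ₃'r hg₁ hg₂ hg₃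
  refine ⟨hIf, ?_, ?_⟩
  · rw [intervalIntegral_iterated3_eq_setIntegral_prod hxr.le hyr.le hzr.le hIf, ef, eg₁, eg₂, eg₃]
    push_cast
    linarith
  · rw [intervalIntegral_iterated3_eq_setIntegral_prod hxr.le hyr.le hzr.le hIf, ef, eg₁, eg₂, eg₃]
    push_cast
    linarith

end PolyMP

end Literature.Analysis.ValidatedNumerics
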